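/-
Copyright (c) 2026 the pub-hodgecm-mathlib formalisation cell (harness21).  Prover seat hodgecm-mathlib-K2E3-p11 (g7), Track B «K2-LIT» ∕ h413
(`stmt-HodgeConjecture-24833`), leaf (nsc-S-A′) «principal-block standard span», case brick C2 «cube» (architect K2E3-p25 (g2) `MEMO-SA-architecture.v2` §3,
dealer K2E3-plan (g4)), file C2b′: CLASS C₄ — THE «W-TRICK» (`W ↪ D′`, `D′ ⁄ W ≅ π₁`, `tr W = tr D′ − tr π₁`).  2026-09-04.
-/
import Summits.HodgeConjecture.HodgeConjecture.Theorems.K2E3GL3CubeConstituents   -- ★ C2b (K2E3-p11): class C₁ (`nonempty_equiv_pi_of_weight_C₁`), `wt_ne_of_apply_ne`; brings C2b-wt ∕ C2b-gen ∕ C2a ∕ REG ∕ …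
import HarnessLib

/-!
# K2_E3 road (h413), leaf (nsc-S-A′), case brick C2 «cube», file C2b′ — class C₄: the W-trick

Cell `pub/hodgecm-mathlib` (D-0151), Track B, seat K2E3-p11 (g7); architecture K2E3-p25 (g2) `MEMO-SA-architecture.v2` §3, C2 PLAN v1 (K2 bus 2026-09-04 11:36Z, (P1) C₄).
`--supports stmt-HodgeConjecture-24833 --as helper`; THEOREMS ONLY (no definition ∕ instance ∕ notation ∕ named fact ∕ `sorry`); COUNT-NEUTRAL.

CURRENCY (★ C2b-wt header): cube letters `a, aν, aν²`, orderings `C₁ = ![a,aν,aν²]`, `C₄ = ![aν,a,aν²]`, `C₄′ = ![aν,aν²,a]`; `I C`, `wt C`, `mult`; `π₁ := 𝟙.twist ((aν)∘det)`;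
`D′ := D(aν ν½, a) = parabolicIndGL F ![f,f,t] (𝟙.twist ψ_Q(aν ν½, a))` (★ STD-EMB ∕ C2a; `D′ ↪ I C₄′`).  HYPOTHESIS-FIRST (discharged BY NAME in the final brick):
`hD′` = GEO-QB (G3c, K2E5-p17 (g7))'s table `mult D′ ζ = [ζ = wt C₄′] + [ζ = wt C₄] + [ζ = wt C₁]` with `[FiniteDimensional ℂ (r_B D′)]`; `hS₁₂` = ★ H0 ED. 2's
`finrank_weightSpace_swap₁₂` at `(x,y,z) = (aν, a, aν²)` for all smooth `V` (RIGIDITY OF THE CLASS C₄: `mult V (wt C₄) = mult V (wt C₄′)`); `hJ₄′` = ★ E4a for `I C₄′`.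

THE MATHEMATICS — ORIENTATION-FREE ([Zelevinsky1980, §1, Thm. 6.1, §9]; [BernsteinZelevinsky1977, §2.3, Cor. 2.13, Thm. 2.9]; [Rodier1982, §5]).  No abstract `L₄` is built; instead,
for ANY irreducible smooth `W` (f.d. `r_B W`) with a C₄-class weight: both C₄-weights occur (rigidity), ★ EMB embeds `W ↪ I C₄′`, whose `wt C₄′`-multiplicity is `1`
(★ REG), so by the SOCLE ARGUMENT (★ C2b-gen) the image lies inside the image of `D′ ↪ I C₄′` (★ C2a; `mult D′ (wt C₄′) = 1` by `hD′`) and `W` factors as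
**`Λ : W ↪ D′`** (§1).  Counting (★ ADD, `hD′`, class C₁ excluded by ★ C2b §1 + ★ C2b-wt's `π₁`-table): **`E(W) = {C₄, C₄′}`** (§1) and the quotient `Q := D′ ⁄ Λ(W)` has the
single weight `wt C₁` with multiplicity one, hence is irreducible (★ C2b-gen (I1), `hJ₄′`) and `≅ π₁` (★ C2b §1), whence **`tr W = tr D′ − tr π₁`** (§2; `D′` admissible,
★ additivity + equivalence-invariance of the character).
HONEST LABEL: HC_CM is proved only modulo the 7 printed citations (2 remaining named inputs: hLiu418 = stmt-HodgeConjecture-24832, h413 = stmt-HodgeConjecture-24833)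
until rung 0 closes; count-neutral helper.

## Mathlib ∕ tree search
Tree ★: C2b `nonempty_equiv_pi_of_weight_C₁`∕`wt_ne_of_apply_ne` · C2b-gen `le_of_isIrreducible_of_finrank_weightSpace_le_one`∕`exists_injective_intertwiningMap_comp_eq_of_range_le`∕`nonempty_equiv_range`∕
`isIrreducible_range`∕`finrank_weightSpace_le_of_injective`∕`isIrreducible_of_finrank_weightSpace_le_one`∕`nontrivial_of_finrank_weightSpace_ne_zero` · C2b-wt `finrank_weightSpace_I_three_perm_eq_one`∕`injective_cube_orderings`∕
`isOpen_ker_letters`∕`isOpen_ker_tch_three`∕`finrank_weightSpace_pi_cube_eq_zero` · C2a `exists_injective_intertwiningMap_D'`∕`cube_letters_ne` · EMB `exists_injective_intertwiningMap_parabolicIndGL` · ADD · EXH · STD-EMB `isAdmissible_D`.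
Dedup: `rg "CubeClassFour|weights_of_weight_C₄|smoothTrace_of_weight_C₄"` — none.

## References
* [Zelevinsky1980] A. V. Zelevinsky, *Induced representations of reductive p-adic groups II*, Ann. Sci. ÉNS 13 (1980), §1, Thm. 6.1, §9.
* [BernsteinZelevinsky1977] I. N. Bernstein, A. V. Zelevinsky, *Induced representations of reductive p-adic groups I*, Ann. Sci. ÉNS 10 (1977), §2.3, Cor. 2.13, Thm. 2.9.
* [Rodier1982] F. Rodier, *Représentations de GL(n, k) où k est un corps p-adique*, Sém. Bourbaki 587 (1982), §5.
-/

set_option autoImplicit false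
-- the mandated namespace repeats the single-problem summit's segment (`HodgeConjecture.HodgeConjecture`)
set_option linter.dupNamespace false

noncomputable section

open Module Function MeasureTheory
open scoped MatrixGroups
open Literature.NumberTheory.Automorphic ValuativeRel Representation
open Literature.NumberTheory.GaloisRepresentations Literature.NumberTheory.GaloisRepresentations.IsNonarchimedeanLocalField
open Literature.RepresentationTheory.FiniteGroups Literature.RepresentationTheory.Semisimple
open Summit.HodgeConjecture.HodgeConjecture.Cruxes.H413.K2E3GL3JacquetMultiplicityAdditive
open Summit.HodgeConjecture.HodgeConjecture.Cruxes.H413.K2E3GL3EmbeddingOfWeight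
open Summit.HodgeConjecture.HodgeConjecture.Cruxes.H413.K2E3GL3PrincipalSeriesExhaustion
open Summit.HodgeConjecture.HodgeConjecture.Cruxes.H413.K2E3GL3ExponentClassTools
open Summit.HodgeConjecture.HodgeConjecture.Cruxes.H413.K2E3GL3StandardModuleEmbedding (isAdmissible_D isOpen_ker_mul_of_isOpen isOpen_ker_nuHalf)
open Summit.HodgeConjecture.HodgeConjecture.Cruxes.H413.K2E3GL3CubeStandardModules
open Summit.HodgeConjecture.HodgeConjecture.Cruxes.H413.K2E3GL3CubeWeights
open Summit.HodgeConjecture.HodgeConjecture.Cruxes.H413.K2E3GL3CubeConstituents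

namespace Summit.HodgeConjecture.HodgeConjecture.Cruxes.H413.K2E3GL3CubeClassFour

variable {F : Type} [Field F] [ValuativeRel F] [TopologicalSpace F] [IsNonarchimedeanLocalField F]
  (a : Fˣ →* ℂˣ) (ha : IsOpen ((a.ker : Subgroup Fˣ) : Set Fˣ))

open scoped Classical

include ha in
/-- `D′ = D(aν ν½, a)` is admissible (★ STD-EMB). [cite: BernsteinZelevinsky1977, Prop. 2.3] -/
theorem isAdmissible_D'_cube : (Representation.parabolicIndGL F (![false, false, true] : Fin 3 → Bool) ((Representation.trivial ℂ (Π t : Bool, GL {i : Fin 3 // (![false, false, true] : Fin 3 → Bool) i = t} F) ℂ).twist ((a * ((unramifiedTwist F 1 : QuasiChar F).toMonoidHom) * ((unramifiedTwist F (1 / 2) : QuasiChar F).toMonoidHom)).comp ((Matrix.GeneralLinearGroup.det : GL {i : Fin 3 // (![false, false, true] : Fin 3 → Bool) i = false} F →* Fˣ).comp (Pi.evalMonoidHom (fun t : Bool => GL {i : Fin 3 // (![false, false, true] : Fin 3 → Bool) i = t} F) false)) * (a).comp ((Matrix.GeneralLinearGroup.det : GL {i : Fin 3 // (![false, false, true]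 : Fin 3 → Bool) i = true} F →* Fˣ).comp (Pi.evalMonoidHom (fun t : Bool => GL {i : Fin 3 // (![false, false, true] : Fin 3 → Bool) i = t} F) true))))).IsAdmissible :=
  isAdmissible_D _ _ (isOpen_ker_mul_of_isOpen (isOpen_ker_letters a ha).1 isOpen_ker_nuHalf) ha

/-- **THE TABLE OF `D′` READ OFF `hD′`** (if-free form): `mult D′ (wt C₄′) = mult D′ (wt C₄) = mult D′ (wt C₁) = 1` and `mult D′ ζ = 0` for every other `ζ`.
[cite: Zelevinsky1980, §1] [cite: BernsteinZelevinsky1977, Thm. 5.2] -/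
theorem table_D'
    (hD' : ∀ ζ : (Π t : Fin 3, GL {i : Fin 3 // (id : Fin 3 → Fin 3) i = t} F) → ℂ, finrank ℂ ↥(⨅ m, Module.End.maxGenEigenspace (Representation.normalizedJacquetGL F (id : Fin 3 → Fin 3) (Representation.parabolicIndGL F (![false, false, true] : Fin 3 → Bool) ((Representation.trivial ℂ (Π t : Bool, GL {i : Fin 3 // (![false, false, true] : Fin 3 → Bool) i = t} F) ℂ).twist ((a * ((unramifiedTwist F 1 : QuasiChar F).toMonoidHom) * ((unramifiedTwist F (1 / 2) : QuasiChar F).toMonoidHom)).comp ((Matrix.GeneralLinearGroup.det : GL {i : Fin 3 // (![false, false, true] : Fin 3 → Bool) i = false} F →* Fˣ).comp (Pi.evalMonoidHom (fun t : Bool => GL {i : Fin 3 // (![false, false, true] : Fin 3 → Bool) i = t} F) false)) * (a).comp ((Matrix.GeneralLinearGroup.det : GL {i : Fin 3 // (![false, false, true] : Fin 3 → Bool) i = true} F →* Fˣ).comp (Pi.evalMonoidHom (fun t : Bool => GL {i : Fin 3 // (![false, false, true] : Fin 3 → Bool) i = t} F) true))))) m) (ζ m)) =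
      (if ζ = (fun m : (Π t : Fin 3, GL {i : Fin 3 // (id : Fin 3 → Fin 3) i = t} F) => ((((∏ i : Fin 3, ((![a * ((unramifiedTwist F 1 : QuasiChar F).toMonoidHom), a * ((unramifiedTwist F 1 : QuasiChar F).toMonoidHom) * ((unramifiedTwist F 1 : QuasiChar F).toMonoidHom), a] : Fin 3 → (Fˣ →* ℂˣ)) i).comp (Matrix.GeneralLinearGroup.det.comp (Pi.evalMonoidHom (fun t : Fin 3 => GL {i : Fin 3 // (id : Fin 3 → Fin 3) i = t} F) i)))) m : ℂˣ) : ℂ)) then 1 else 0) + (if ζ = (fun m : (Π t : Fin 3, GL {i : Fin 3 // (id : Fin 3 → Fin 3) i = t} F) => ((((∏ i : Fin 3, ((![a * ((unramifiedTwist F 1 : QuasiChar F).toMonoidHom), a, a * ((unramifiedTwist F 1 : QuasiChar F).toMonoidHom) * ((unramifiedTwist F 1 : QuasiChar F).toMonoidHom)] : Fin 3 → (Fˣ →* ℂˣ)) i).comp (Matrix.GeneralLinearGroup.det.comp (Pi.evalMonoidHom (fun t : Fin 3 => GL {i : Fin 3 // (id : Fin 3 → Fin 3) i = t} F) i)))) m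 : ℂˣ) : ℂ)) then 1 else 0) + (if ζ = (fun m : (Π t : Fin 3, GL {i : Fin 3 // (id : Fin 3 → Fin 3) i = t} F) => ((((∏ i : Fin 3, ((![a, a * ((unramifiedTwist F 1 : QuasiChar F).toMonoidHom), a * ((unramifiedTwist F 1 : QuasiChar F).toMonoidHom) * ((unramifiedTwist F 1 : QuasiChar F).toMonoidHom)] : Fin 3 → (Fˣ →* ℂˣ)) i).comp (Matrix.GeneralLinearGroup.det.comp (Pi.evalMonoidHom (fun t : Fin 3 => GL {i : Fin 3 // (id : Fin 3 → Fin 3) i = t} F) i)))) m : ℂˣ) : ℂ)) then 1 else 0)) :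
    finrank ℂ ↥(⨅ m, Module.End.maxGenEigenspace (Representation.normalizedJacquetGL F (id : Fin 3 → Fin 3) (Representation.parabolicIndGL F (![false, false, true] : Fin 3 → Bool) ((Representation.trivial ℂ (Π t : Bool, GL {i : Fin 3 // (![false, false, true] : Fin 3 → Bool) i = t} F) ℂ).twist ((a * ((unramifiedTwist F 1 : QuasiChar F).toMonoidHom) * ((unramifiedTwist F (1 / 2) : QuasiChar F).toMonoidHom)).comp ((Matrix.GeneralLinearGroup.det : GL {i : Fin 3 // (![false, false, true] : Fin 3 → Bool) i = false} F →* Fˣ).comp (Pi.evalMonoidHom (fun t : Bool => GL {i : Fin 3 // (![false, false, true] : Fin 3 → Bool) i = t} F) false)) * (a).comp ((Matrix.GeneralLinearGroup.det : GL {i : Fin 3 // (![false, false, true] : Fin 3 → Bool) i = true} F →* Fˣ).comp (Pi.evalMonoidHom (fun t : Bool => GL {i : Fin 3 // (![false, false, true] : Fin 3 → Bool) i = t} F) true))))) m) (((((∏ i : Fin 3, ((![a * ((unramifiedTwist F 1 : QuasiChar F).toMonoidHom), a * ((unramifiedTwist F 1 : QuasiChar F).toMonoidHom) * ((unramifiedTwist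 F 1 : QuasiChar F).toMonoidHom), a] : Fin 3 → (Fˣ →* ℂˣ)) i).comp (Matrix.GeneralLinearGroup.det.comp (Pi.evalMonoidHom (fun t : Fin 3 => GL {i : Fin 3 // (id : Fin 3 → Fin 3) i = t} F) i)))) m : ℂˣ) : ℂ))) = 1 ∧
    finrank ℂ ↥(⨅ m, Module.End.maxGenEigenspace (Representation.normalizedJacquetGL F (id : Fin 3 → Fin 3) (Representation.parabolicIndGL F (![false, false, true] : Fin 3 → Bool) ((Representation.trivial ℂ (Π t : Bool, GL {i : Fin 3 // (![false, false, true] : Fin 3 → Bool) i = t} F) ℂ).twist ((a * ((unramifiedTwist F 1 : QuasiChar F).toMonoidHom) * ((unramifiedTwist F (1 / 2) : QuasiChar F).toMonoidHom)).comp ((Matrix.GeneralLinearGroup.det : GL {i : Fin 3 // (![false, false, true] : Fin 3 → Bool) i = false} F →* Fˣ).comp (Pi.evalMonoidHom (fun t : Bool => GL {i : Fin 3 // (![false, false, true] : Fin 3 → Bool) i = t} F) false)) * (a).comp ((Matrix.GeneralLinearGroup.det : GL {i : Fin 3 // (![false, false, true] : Fin 3 → Bool) i = true} F →* Fˣ).comp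 (Pi.evalMonoidHom (fun t : Bool => GL {i : Fin 3 // (![false, false, true] : Fin 3 → Bool) i = t} F) true))))) m) (((((∏ i : Fin 3, ((![a * ((unramifiedTwist F 1 : QuasiChar F).toMonoidHom), a, a * ((unramifiedTwist F 1 : QuasiChar F).toMonoidHom) * ((unramifiedTwist F 1 : QuasiChar F).toMonoidHom)] : Fin 3 → (Fˣ →* ℂˣ)) i).comp (Matrix.GeneralLinearGroup.det.comp (Pi.evalMonoidHom (fun t : Fin 3 => GL {i : Fin 3 // (id : Fin 3 → Fin 3) i = t} F) i)))) m : ℂˣ) : ℂ))) = 1 ∧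
    finrank ℂ ↥(⨅ m, Module.End.maxGenEigenspace (Representation.normalizedJacquetGL F (id : Fin 3 → Fin 3) (Representation.parabolicIndGL F (![false, false, true] : Fin 3 → Bool) ((Representation.trivial ℂ (Π t : Bool, GL {i : Fin 3 // (![false, false, true] : Fin 3 → Bool) i = t} F) ℂ).twist ((a * ((unramifiedTwist F 1 : QuasiChar F).toMonoidHom) * ((unramifiedTwist F (1 / 2) : QuasiChar F).toMonoidHom)).comp ((Matrix.GeneralLinearGroup.det : GL {i : Fin 3 // (![false, false, true] : Fin 3 → Bool) i = false} F →* Fˣ).comp (Pi.evalMonoidHom (fun t : Bool => GL {i : Fin 3 // (![false, false, true] : Fin 3 → Bool) i = t} F) false)) * (a).comp ((Matrix.GeneralLinearGroup.det : GL {i : Fin 3 // (![false, false, true] : Fin 3 → Bool) i = true} F →* Fˣ).comp (Pi.evalMonoidHom (fun t : Bool => GL {i : Fin 3 // (![false, false, true] : Fin 3 → Bool) i = t} F) true))))) m) (((((∏ i : Fin 3, ((![a, a * ((unramifiedTwist F 1 : QuasiChar F).toMonoidHom), a * ((unramifiedTwist F 1 : QuasiChar F).toMonoidHom) * ((unramifiedTwist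 F 1 : QuasiChar F).toMonoidHom)] : Fin 3 → (Fˣ →* ℂˣ)) i).comp (Matrix.GeneralLinearGroup.det.comp (Pi.evalMonoidHom (fun t : Fin 3 => GL {i : Fin 3 // (id : Fin 3 → Fin 3) i = t} F) i)))) m : ℂˣ) : ℂ))) = 1 ∧
    ∀ ζ : (Π t : Fin 3, GL {i : Fin 3 // (id : Fin 3 → Fin 3) i = t} F) → ℂ, ζ ≠ (fun m : (Π t : Fin 3, GL {i : Fin 3 // (id : Fin 3 → Fin 3) i = t} F) => ((((∏ i : Fin 3, ((![a * ((unramifiedTwist F 1 : QuasiChar F).toMonoidHom), a * ((unramifiedTwist F 1 : QuasiChar F).toMonoidHom) * ((unramifiedTwist F 1 : QuasiChar F).toMonoidHom), a] : Fin 3 → (Fˣ →* ℂˣ)) i).comp (Matrix.GeneralLinearGroup.det.comp (Pi.evalMonoidHom (fun t : Fin 3 => GL {i : Fin 3 // (id : Fin 3 → Fin 3) i = t} F) i)))) m : ℂˣ) : ℂ)) → ζ ≠ (fun m : (Π t : Fin 3, GL {i : Fin 3 // (id : Fin 3 → Fin 3) i = t} F) => ((((∏ i : Fin 3, ((![a *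 ((unramifiedTwist F 1 : QuasiChar F).toMonoidHom), a, a * ((unramifiedTwist F 1 : QuasiChar F).toMonoidHom) * ((unramifiedTwist F 1 : QuasiChar F).toMonoidHom)] : Fin 3 → (Fˣ →* ℂˣ)) i).comp (Matrix.GeneralLinearGroup.det.comp (Pi.evalMonoidHom (fun t : Fin 3 => GL {i : Fin 3 // (id : Fin 3 → Fin 3) i = t} F) i)))) m : ℂˣ) : ℂ)) → ζ ≠ (fun m : (Π t : Fin 3, GL {i : Fin 3 // (id : Fin 3 → Fin 3) i = t} F) => ((((∏ i : Fin 3, ((![a, a * ((unramifiedTwist F 1 : QuasiChar F).toMonoidHom), a * ((unramifiedTwist F 1 : QuasiChar F).toMonoidHom) * ((unramifiedTwist F 1 : QuasiChar F).toMonoidHom)] : Fin 3 → (Fˣ →* ℂˣ)) i).comp (Matrix.GeneralLinearGroup.det.comp (Pi.evalMonoidHom (fun t : Fin 3 => GL {i : Fin 3 // (id : Fin 3 → Fin 3) i = t} F) i)))) m : ℂˣ) : ℂ)) →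
      finrank ℂ ↥(⨅ m, Module.End.maxGenEigenspace (Representation.normalizedJacquetGL F (id : Fin 3 → Fin 3) (Representation.parabolicIndGL F (![false, false, true] : Fin 3 → Bool) ((Representation.trivial ℂ (Π t : Bool, GL {i : Fin 3 // (![false, false, true] : Fin 3 → Bool) i = t} F) ℂ).twist ((a * ((unramifiedTwist F 1 : QuasiChar F).toMonoidHom) * ((unramifiedTwist F (1 / 2) : QuasiChar F).toMonoidHom)).comp ((Matrix.GeneralLinearGroup.det : GL {i : Fin 3 // (![false, false, true] : Fin 3 → Bool) i = false} F →* Fˣ).comp (Pi.evalMonoidHom (fun t : Bool => GL {i : Fin 3 // (![false, false, true] : Fin 3 → Bool) i = t} F) false)) * (a).comp ((Matrix.GeneralLinearGroup.det : GL {i : Fin 3 // (![false, false, true] : Fin 3 → Bool) i = true} F →* Fˣ).comp (Pi.evalMonoidHom (fun t : Bool => GL {i : Fin 3 // (![false, false, true] : Fin 3 → Bool) i = t} F) true))))) m) (ζ m)) = 0 := by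
  have hne := cube_letters_ne a
  have n4p4 : (fun m : (Π t : Fin 3, GL {i : Fin 3 // (id : Fin 3 → Fin 3) i = t} F) => ((((∏ i : Fin 3, ((![a * ((unramifiedTwist F 1 : QuasiChar F).toMonoidHom), a * ((unramifiedTwist F 1 : QuasiChar F).toMonoidHom) * ((unramifiedTwist F 1 : QuasiChar F).toMonoidHom), a] : Fin 3 → (Fˣ →* ℂˣ)) i).comp (Matrix.GeneralLinearGroup.det.comp (Pi.evalMonoidHom (fun t : Fin 3 => GL {i : Fin 3 // (id : Fin 3 → Fin 3) i = t} F) i)))) m : ℂˣ) : ℂ)) ≠ (fun m : (Π t : Fin 3, GL {i : Fin 3 // (id : Fin 3 → Fin 3) i = t} F) => ((((∏ i : Fin 3, ((![a * ((unramifiedTwist F 1 : QuasiChar F).toMonoidHom), a, a * ((unramifiedTwist F 1 : QuasiChar F).toMonoidHom) * ((unramifiedTwist F 1 : QuasiChar F).toMonoidHom)] : Fin 3 → (Fˣ →* ℂˣ)) i).comp (Matrix.GeneralLinearGroup.det.comp (Pi.evalMonoidHom (fun t : Fin 3 => GL {i : Fin 3 // (id : Fin 3 → Fin 3) i = t} F)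 i)))) m : ℂˣ) : ℂ)) := wt_ne_of_apply_ne _ _ 1 (by simpa using hne.2.1)
  have n4p1 : (fun m : (Π t : Fin 3, GL {i : Fin 3 // (id : Fin 3 → Fin 3) i = t} F) => ((((∏ i : Fin 3, ((![a * ((unramifiedTwist F 1 : QuasiChar F).toMonoidHom), a * ((unramifiedTwist F 1 : QuasiChar F).toMonoidHom) * ((unramifiedTwist F 1 : QuasiChar F).toMonoidHom), a] : Fin 3 → (Fˣ →* ℂˣ)) i).comp (Matrix.GeneralLinearGroup.det.comp (Pi.evalMonoidHom (fun t : Fin 3 => GL {i : Fin 3 // (id : Fin 3 → Fin 3) i = t} F) i)))) m : ℂˣ) : ℂ)) ≠ (fun m : (Π t : Fin 3, GL {i : Fin 3 // (id : Fin 3 → Fin 3) i = t} F) => ((((∏ i : Fin 3, ((![a, a * ((unramifiedTwist F 1 : QuasiChar F).toMonoidHom), a * ((unramifiedTwist F 1 : QuasiChar F).toMonoidHom) * ((unramifiedTwist F 1 : QuasiChar F).toMonoidHom)] : Fin 3 → (Fˣ →* ℂˣ)) i).comp (Matrix.GeneralLinearGroup.det.comp (Pi.evalMonoidHom (fun t :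 Fin 3 => GL {i : Fin 3 // (id : Fin 3 → Fin 3) i = t} F) i)))) m : ℂˣ) : ℂ)) := wt_ne_of_apply_ne _ _ 0 (by simpa using hne.1)
  have n41 : (fun m : (Π t : Fin 3, GL {i : Fin 3 // (id : Fin 3 → Fin 3) i = t} F) => ((((∏ i : Fin 3, ((![a * ((unramifiedTwist F 1 : QuasiChar F).toMonoidHom), a, a * ((unramifiedTwist F 1 : QuasiChar F).toMonoidHom) * ((unramifiedTwist F 1 : QuasiChar F).toMonoidHom)] : Fin 3 → (Fˣ →* ℂˣ)) i).comp (Matrix.GeneralLinearGroup.det.comp (Pi.evalMonoidHom (fun t : Fin 3 => GL {i : Fin 3 // (id : Fin 3 → Fin 3) i = t} F) i)))) m : ℂˣ) : ℂ)) ≠ (fun m : (Π t : Fin 3, GL {i : Fin 3 // (id : Fin 3 → Fin 3) i = t} F) => ((((∏ i : Fin 3, ((![a, a * ((unramifiedTwist F 1 : QuasiChar F).toMonoidHom), a * ((unramifiedTwist F 1 : QuasiChar F).toMonoidHom) * ((unramifiedTwist F 1 : QuasiChar F).toMonoidHom)] : Fin 3 → (Fˣ →* ℂˣ)) i).comp (Matrix.GeneralLinearGroup.det.comp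 (Pi.evalMonoidHom (fun t : Fin 3 => GL {i : Fin 3 // (id : Fin 3 → Fin 3) i = t} F) i)))) m : ℂˣ) : ℂ)) := wt_ne_of_apply_ne _ _ 0 (by simpa using hne.1)
  refine ⟨?_, ?_, ?_, fun ζ hζ4p hζ4 hζ1 => ?_⟩
  · have := hD' (fun m : (Π t : Fin 3, GL {i : Fin 3 // (id : Fin 3 → Fin 3) i = t} F) => ((((∏ i : Fin 3, ((![a * ((unramifiedTwist F 1 : QuasiChar F).toMonoidHom), a * ((unramifiedTwist F 1 : QuasiChar F).toMonoidHom) * ((unramifiedTwist F 1 : QuasiChar F).toMonoidHom), a] : Fin 3 → (Fˣ →* ℂˣ)) i).comp (Matrix.GeneralLinearGroup.det.comp (Pi.evalMonoidHom (fun t : Fin 3 => GL {i : Fin 3 // (id : Fin 3 → Fin 3) i = t} F) i)))) m : ℂˣ) : ℂ))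
    simp only [n4p4, n4p1, if_true, if_false, add_zero] at this
    exact this
  · have := hD' (fun m : (Π t : Fin 3, GL {i : Fin 3 // (id : Fin 3 → Fin 3) i = t} F) => ((((∏ i : Fin 3, ((![a * ((unramifiedTwist F 1 : QuasiChar F).toMonoidHom), a, a * ((unramifiedTwist F 1 : QuasiChar F).toMonoidHom) * ((unramifiedTwist F 1 : QuasiChar F).toMonoidHom)] : Fin 3 → (Fˣ →* ℂˣ)) i).comp (Matrix.GeneralLinearGroup.det.comp (Pi.evalMonoidHom (fun t : Fin 3 => GL {i : Fin 3 // (id : Fin 3 → Fin 3) i = t} F) i)))) m : ℂˣ) : ℂ))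
    simp only [n4p4.symm, n41, if_true, if_false, add_zero, zero_add] at this
    exact this
  · have := hD' (fun m : (Π t : Fin 3, GL {i : Fin 3 // (id : Fin 3 → Fin 3) i = t} F) => ((((∏ i : Fin 3, ((![a, a * ((unramifiedTwist F 1 : QuasiChar F).toMonoidHom), a * ((unramifiedTwist F 1 : QuasiChar F).toMonoidHom) * ((unramifiedTwist F 1 : QuasiChar F).toMonoidHom)] : Fin 3 → (Fˣ →* ℂˣ)) i).comp (Matrix.GeneralLinearGroup.det.comp (Pi.evalMonoidHom (fun t : Fin 3 => GL {i : Fin 3 // (id : Fin 3 → Fin 3) i = t} F) i)))) m : ℂˣ) : ℂ))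
    simp only [n4p1.symm, n41.symm, if_true, if_false, zero_add] at this
    exact this
  · have := hD' ζ
    simp only [hζ4p, hζ4, hζ1, if_false, add_zero] at this
    exact this

/-! ## §1 `W ↪ D′` and `E(W) = {C₄, C₄′}` -/

include ha in
/-- **THE W-TRICK, embedding half: an irreducible smooth `W` with a C₄-class weight embeds in `D′`** (★ EMB into `I C₄′`, socle argument against `D′ ↪ I C₄′`, factoring).
[cite: Zelevinsky1980, Thm. 6.1, §9] [cite: BernsteinZelevinsky1977, Cor. 2.13, §2.3] -/
theorem exists_injective_intertwiningMap_D'_of_weight_C₄ [FiniteDimensional ℂ (Representation.restrictUnipotentGL F (id : Fin 3 → Fin 3) (Representation.parabolicIndGL F (![false, false, true] : Fin 3 → Bool) ((Representation.trivial ℂ (Π t : Bool, GL {i : Fin 3 // (![false, false, true] : Fin 3 → Bool) i = t} F) ℂ).twist ((a * ((unramifiedTwist F 1 : QuasiChar F).toMonoidHom) * ((unramifiedTwist F (1 / 2) : QuasiChar F).toMonoidHom)).comp ((Matrix.GeneralLinearGroup.det : GL {i : Fin 3 // (![false, false, true] : Fin 3 → Bool) i = false} F →* Fˣ).comp (Pi.evalMonoidHom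 (fun t : Bool => GL {i : Fin 3 // (![false, false, true] : Fin 3 → Bool) i = t} F) false)) * (a).comp ((Matrix.GeneralLinearGroup.det : GL {i : Fin 3 // (![false, false, true] : Fin 3 → Bool) i = true} F →* Fˣ).comp (Pi.evalMonoidHom (fun t : Bool => GL {i : Fin 3 // (![false, false, true] : Fin 3 → Bool) i = t} F) true)))))).Coinvariants]
    (hD' : ∀ ζ : (Π t : Fin 3, GL {i : Fin 3 // (id : Fin 3 → Fin 3) i = t} F) → ℂ, finrank ℂ ↥(⨅ m, Module.End.maxGenEigenspace (Representation.normalizedJacquetGL F (id : Fin 3 → Fin 3) (Representation.parabolicIndGL F (![false, false, true] : Fin 3 → Bool) ((Representation.trivial ℂ (Π t : Bool, GL {i : Fin 3 // (![false, false, true] : Fin 3 → Bool) i = t} F) ℂ).twist ((a * ((unramifiedTwist F 1 : QuasiChar F).toMonoidHom) * ((unramifiedTwist F (1 / 2) : QuasiChar F).toMonoidHom)).comp ((Matrix.GeneralLinearGroup.det : GL {i : Fin 3 // (![false, false, true] : Fin 3 → Bool) i = false} F →* Fˣ).comp (Pi.evalMonoidHom (fun t : Bool => GL {i : Fin 3 //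 (![false, false, true] : Fin 3 → Bool) i = t} F) false)) * (a).comp ((Matrix.GeneralLinearGroup.det : GL {i : Fin 3 // (![false, false, true] : Fin 3 → Bool) i = true} F →* Fˣ).comp (Pi.evalMonoidHom (fun t : Bool => GL {i : Fin 3 // (![false, false, true] : Fin 3 → Bool) i = t} F) true))))) m) (ζ m)) =
      (if ζ = (fun m : (Π t : Fin 3, GL {i : Fin 3 // (id : Fin 3 → Fin 3) i = t} F) => ((((∏ i : Fin 3, ((![a * ((unramifiedTwist F 1 : QuasiChar F).toMonoidHom), a * ((unramifiedTwist F 1 : QuasiChar F).toMonoidHom) * ((unramifiedTwist F 1 : QuasiChar F).toMonoidHom), a] : Fin 3 → (Fˣ →* ℂˣ)) i).comp (Matrix.GeneralLinearGroup.det.comp (Pi.evalMonoidHom (fun t : Fin 3 => GL {i : Fin 3 // (id : Fin 3 → Fin 3) i = t} F) i)))) m : ℂˣ) : ℂ)) then 1 else 0) + (if ζ = (fun m : (Π t : Fin 3, GL {i : Fin 3 // (id : Fin 3 → Fin 3) i = t} F) => ((((∏ i : Fin 3, ((![a * ((unramifiedTwist F 1 : QuasiChar F).toMonoidHom), a, a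 * ((unramifiedTwist F 1 : QuasiChar F).toMonoidHom) * ((unramifiedTwist F 1 : QuasiChar F).toMonoidHom)] : Fin 3 → (Fˣ →* ℂˣ)) i).comp (Matrix.GeneralLinearGroup.det.comp (Pi.evalMonoidHom (fun t : Fin 3 => GL {i : Fin 3 // (id : Fin 3 → Fin 3) i = t} F) i)))) m : ℂˣ) : ℂ)) then 1 else 0) + (if ζ = (fun m : (Π t : Fin 3, GL {i : Fin 3 // (id : Fin 3 → Fin 3) i = t} F) => ((((∏ i : Fin 3, ((![a, a * ((unramifiedTwist F 1 : QuasiChar F).toMonoidHom), a * ((unramifiedTwist F 1 : QuasiChar F).toMonoidHom) * ((unramifiedTwist F 1 : QuasiChar F).toMonoidHom)] : Fin 3 → (Fˣ →* ℂˣ)) i).comp (Matrix.GeneralLinearGroup.det.comp (Pi.evalMonoidHom (fun t : Fin 3 => GL {i : Fin 3 // (id : Fin 3 → Fin 3) i = t} F) i)))) m : ℂˣ) : ℂ)) then 1 else 0))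
    (hS₁₂ : ∀ {Y : Type} [AddCommGroup Y] [Module ℂ Y] (V : Representation ℂ (GL (Fin 3) F) Y), V.IsSmooth → ∀ [FiniteDimensional ℂ (Representation.restrictUnipotentGL F (id : Fin 3 → Fin 3) V).Coinvariants],
      finrank ℂ ↥(⨅ m, Module.End.maxGenEigenspace (Representation.normalizedJacquetGL F (id : Fin 3 → Fin 3) V m) (((((∏ i : Fin 3, ((![a * ((unramifiedTwist F 1 : QuasiChar F).toMonoidHom), a, a * ((unramifiedTwist F 1 : QuasiChar F).toMonoidHom) * ((unramifiedTwist F 1 : QuasiChar F).toMonoidHom)] : Fin 3 → (Fˣ →* ℂˣ)) i).comp (Matrix.GeneralLinearGroup.det.comp (Pi.evalMonoidHom (fun t : Fin 3 => GL {i : Fin 3 // (id : Fin 3 → Fin 3) i = t} F) i)))) m : ℂˣ) : ℂ))) =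
        finrank ℂ ↥(⨅ m, Module.End.maxGenEigenspace (Representation.normalizedJacquetGL F (id : Fin 3 → Fin 3) V m) (((((∏ i : Fin 3, ((![a * ((unramifiedTwist F 1 : QuasiChar F).toMonoidHom), a * ((unramifiedTwist F 1 : QuasiChar F).toMonoidHom) * ((unramifiedTwist F 1 : QuasiChar F).toMonoidHom), a] : Fin 3 → (Fˣ →* ℂˣ)) i).comp (Matrix.GeneralLinearGroup.det.comp (Pi.evalMonoidHom (fun t : Fin 3 => GL {i : Fin 3 // (id : Fin 3 → Fin 3) i = t} F) i)))) m : ℂˣ) : ℂ)))) {Y : Type} [AddCommGroup Y] [Module ℂ Y] (W : Representation ℂ (GL (Fin 3) F) Y) [W.IsIrreducible] (hW : W.IsSmooth)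
    [FiniteDimensional ℂ (Representation.restrictUnipotentGL F (id : Fin 3 → Fin 3) W).Coinvariants]
    (h : finrank ℂ ↥(⨅ m, Module.End.maxGenEigenspace (Representation.normalizedJacquetGL F (id : Fin 3 → Fin 3) W m) (((((∏ i : Fin 3, ((![a * ((unramifiedTwist F 1 : QuasiChar F).toMonoidHom), a, a * ((unramifiedTwist F 1 : QuasiChar F).toMonoidHom) * ((unramifiedTwist F 1 : QuasiChar F).toMonoidHom)] : Fin 3 → (Fˣ →* ℂˣ)) i).comp (Matrix.GeneralLinearGroup.det.comp (Pi.evalMonoidHom (fun t : Fin 3 => GL {i : Fin 3 // (id : Fin 3 → Fin 3) i = t} F) i)))) m : ℂˣ) : ℂ))) ≠ 0 ∨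
      finrank ℂ ↥(⨅ m, Module.End.maxGenEigenspace (Representation.normalizedJacquetGL F (id : Fin 3 → Fin 3) W m) (((((∏ i : Fin 3, ((![a * ((unramifiedTwist F 1 : QuasiChar F).toMonoidHom), a * ((unramifiedTwist F 1 : QuasiChar F).toMonoidHom) * ((unramifiedTwist F 1 : QuasiChar F).toMonoidHom), a] : Fin 3 → (Fˣ →* ℂˣ)) i).comp (Matrix.GeneralLinearGroup.det.comp (Pi.evalMonoidHom (fun t : Fin 3 => GL {i : Fin 3 // (id : Fin 3 → Fin 3) i = t} F) i)))) m : ℂˣ) : ℂ))) ≠ 0) :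
    ∃ Λ : W.IntertwiningMap (Representation.parabolicIndGL F (![false, false, true] : Fin 3 → Bool) ((Representation.trivial ℂ (Π t : Bool, GL {i : Fin 3 // (![false, false, true] : Fin 3 → Bool) i = t} F) ℂ).twist ((a * ((unramifiedTwist F 1 : QuasiChar F).toMonoidHom) * ((unramifiedTwist F (1 / 2) : QuasiChar F).toMonoidHom)).comp ((Matrix.GeneralLinearGroup.det : GL {i : Fin 3 // (![false, false, true] : Fin 3 → Bool) i = false} F →* Fˣ).comp (Pi.evalMonoidHom (fun t : Bool => GL {i : Fin 3 // (![false, false, true] : Fin 3 → Bool) i = t} F) false)) * (a).comp ((Matrix.GeneralLinearGroup.det : GL {i : Fin 3 // (![false, false, true] : Fin 3 → Bool) i = true} F →* Fˣ).comp (Pi.evalMonoidHom (fun t : Bool => GL {i : Fin 3 // (![false, false, true] : Fin 3 → Bool) i = t} F) true))))), Function.Injective Λ := by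
  have h4p : finrank ℂ ↥(⨅ m, Module.End.maxGenEigenspace (Representation.normalizedJacquetGL F (id : Fin 3 → Fin 3) W m) (((((∏ i : Fin 3, ((![a * ((unramifiedTwist F 1 : QuasiChar F).toMonoidHom), a * ((unramifiedTwist F 1 : QuasiChar F).toMonoidHom) * ((unramifiedTwist F 1 : QuasiChar F).toMonoidHom), a] : Fin 3 → (Fˣ →* ℂˣ)) i).comp (Matrix.GeneralLinearGroup.det.comp (Pi.evalMonoidHom (fun t : Fin 3 => GL {i : Fin 3 // (id : Fin 3 → Fin 3) i = t} F) i)))) m : ℂˣ) : ℂ))) ≠ 0 := by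
    rcases h with h | h
    · rwa [← hS₁₂ W hW]
    · exact h
  have hD's := (isAdmissible_D'_cube a ha).isSmooth
  have hI's : (Representation.parabolicIndGL F (id : Fin 3 → Fin 3) ((Representation.trivial ℂ (Π t : Fin 3, GL {i : Fin 3 // (id : Fin 3 → Fin 3) i = t} F) ℂ).twist (∏ i : Fin 3, ((![a * ((unramifiedTwist F 1 : QuasiChar F).toMonoidHom), a * ((unramifiedTwist F 1 : QuasiChar F).toMonoidHom) * ((unramifiedTwist F 1 : QuasiChar F).toMonoidHom), a] : Fin 3 → (Fˣ →* ℂˣ)) i).comp (Matrix.GeneralLinearGroup.det.comp (Pi.evalMonoidHom (fun t : Fin 3 => GL {i : Fin 3 // (id : Fin 3 → Fin 3) i = t} F) i))))).IsSmooth := isSmooth_principalSeries _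
  haveI : FiniteDimensional ℂ (Representation.restrictUnipotentGL F (id : Fin 3 → Fin 3) (Representation.parabolicIndGL F (id : Fin 3 → Fin 3) ((Representation.trivial ℂ (Π t : Fin 3, GL {i : Fin 3 // (id : Fin 3 → Fin 3) i = t} F) ℂ).twist (∏ i : Fin 3, ((![a * ((unramifiedTwist F 1 : QuasiChar F).toMonoidHom), a * ((unramifiedTwist F 1 : QuasiChar F).toMonoidHom) * ((unramifiedTwist F 1 : QuasiChar F).toMonoidHom), a] : Fin 3 → (Fˣ →* ℂˣ)) i).comp (Matrix.GeneralLinearGroup.det.comp (Pi.evalMonoidHom (fun t : Fin 3 => GL {i : Fin 3 // (id : Fin 3 → Fin 3) i = t} F) i)))))).Coinvariants :=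
    finiteDimensional_jacquet_principalSeries _ (isOpen_ker_tch_three _ _ _ (isOpen_ker_letters a ha).1 (isOpen_ker_letters a ha).2 ha)
  have h_ob := exists_injective_intertwiningMap_parabolicIndGL W hW (∏ i : Fin 3, ((![a * ((unramifiedTwist F 1 : QuasiChar F).toMonoidHom), a * ((unramifiedTwist F 1 : QuasiChar F).toMonoidHom) * ((unramifiedTwist F 1 : QuasiChar F).toMonoidHom), a] : Fin 3 → (Fˣ →* ℂˣ)) i).comp (Matrix.GeneralLinearGroup.det.comp (Pi.evalMonoidHom (fun t : Fin 3 => GL {i : Fin 3 // (id : Fin 3 → Fin 3) i = t} F) i))) h4p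
  obtain ⟨ΦW, hΦW⟩ := h_ob
  have h_ob := exists_injective_intertwiningMap_D' a ha
  obtain ⟨ΦD, hΦD⟩ := h_ob
  haveI := isIrreducible_range ΦW hΦW
  have h_ob := nonempty_equiv_range ΦW hΦW
  obtain ⟨eW⟩ := h_ob
  have h_ob := nonempty_equiv_range ΦD hΦD
  obtain ⟨eD⟩ := h_ob
  have hle : ΦW.range ≤ ΦD.range := by
    refine le_of_isIrreducible_of_finrank_weightSpace_le_one (Representation.parabolicIndGL F (id : Fin 3 → Fin 3) ((Representation.trivial ℂ (Π t : Fin 3, GL {i : Fin 3 // (id : Fin 3 → Fin 3) i = t} F) ℂ).twist (∏ i : Fin 3, ((![a * ((unramifiedTwist F 1 : QuasiChar F).toMonoidHom), a * ((unramifiedTwist F 1 : QuasiChar F).toMonoidHom) * ((unramifiedTwist F 1 : QuasiChar F).toMonoidHom), a] : Fin 3 → (Fˣ →* ℂˣ)) i).comp (Matrix.GeneralLinearGroup.det.comp (Pi.evalMonoidHom (fun t : Fin 3 => GL {i : Fin 3 // (id : Fin 3 → Fin 3) i = t} F) i))))) hI's ΦW.range ΦD.range (fun m : (Π t : Fin 3,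 GL {i : Fin 3 // (id : Fin 3 → Fin 3) i = t} F) => ((((∏ i : Fin 3, ((![a * ((unramifiedTwist F 1 : QuasiChar F).toMonoidHom), a * ((unramifiedTwist F 1 : QuasiChar F).toMonoidHom) * ((unramifiedTwist F 1 : QuasiChar F).toMonoidHom), a] : Fin 3 → (Fˣ →* ℂˣ)) i).comp (Matrix.GeneralLinearGroup.det.comp (Pi.evalMonoidHom (fun t : Fin 3 => GL {i : Fin 3 // (id : Fin 3 → Fin 3) i = t} F) i)))) m : ℂˣ) : ℂ)) ?_ ?_ ?_
    · exact (finrank_weightSpace_I_three_perm_eq_one _ _ _ (isOpen_ker_letters a ha).1 (isOpen_ker_letters a ha).2 ha (injective_cube_orderings a).2.2.2.2.2 1 _ (fun i => rfl)).le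
    · intro h0
      have := finrank_weightSpace_eq_of_equiv _ _ eW (fun m : (Π t : Fin 3, GL {i : Fin 3 // (id : Fin 3 → Fin 3) i = t} F) => ((((∏ i : Fin 3, ((![a * ((unramifiedTwist F 1 : QuasiChar F).toMonoidHom), a * ((unramifiedTwist F 1 : QuasiChar F).toMonoidHom) * ((unramifiedTwist F 1 : QuasiChar F).toMonoidHom), a] : Fin 3 → (Fˣ →* ℂˣ)) i).comp (Matrix.GeneralLinearGroup.det.comp (Pi.evalMonoidHom (fun t : Fin 3 => GL {i : Fin 3 // (id : Fin 3 → Fin 3) i = t} F) i)))) m : ℂˣ) : ℂ))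
      exact h4p (this.trans h0)
    · intro h0
      have := finrank_weightSpace_eq_of_equiv _ _ eD (fun m : (Π t : Fin 3, GL {i : Fin 3 // (id : Fin 3 → Fin 3) i = t} F) => ((((∏ i : Fin 3, ((![a * ((unramifiedTwist F 1 : QuasiChar F).toMonoidHom), a * ((unramifiedTwist F 1 : QuasiChar F).toMonoidHom) * ((unramifiedTwist F 1 : QuasiChar F).toMonoidHom), a] : Fin 3 → (Fˣ →* ℂˣ)) i).comp (Matrix.GeneralLinearGroup.det.comp (Pi.evalMonoidHom (fun t : Fin 3 => GL {i : Fin 3 // (id : Fin 3 → Fin 3) i = t} F) i)))) m : ℂˣ) : ℂ))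
      have := (table_D' a hD').1
      linarith
  have h_ob := exists_injective_intertwiningMap_comp_eq_of_range_le ΦD hΦD ΦW hΦW hle
  obtain ⟨Λ, hΛ, -⟩ := h_ob
  exact ⟨Λ, hΛ⟩

include ha in
/-- **`E(W) = {C₄, C₄′}` with multiplicity one** for an irreducible smooth `W` with a C₄-class weight (`W ↪ D′` bounds `E(W) ⊆ E(D′) = {C₄′, C₄, C₁}`, rigidity gives both C₄-weights,
and `wt C₁` is excluded: a `W` with `wt C₁` is `≅ π₁`, which has no C₄-weight). [cite: Zelevinsky1980, Thm. 6.1, §9] [cite: BernsteinZelevinsky1977, §2.3] -/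
theorem weights_of_weight_C₄ [FiniteDimensional ℂ (Representation.restrictUnipotentGL F (id : Fin 3 → Fin 3) (Representation.parabolicIndGL F (![false, false, true] : Fin 3 → Bool) ((Representation.trivial ℂ (Π t : Bool, GL {i : Fin 3 // (![false, false, true] : Fin 3 → Bool) i = t} F) ℂ).twist ((a * ((unramifiedTwist F 1 : QuasiChar F).toMonoidHom) * ((unramifiedTwist F (1 / 2) : QuasiChar F).toMonoidHom)).comp ((Matrix.GeneralLinearGroup.det : GL {i : Fin 3 // (![false, false, true] : Fin 3 → Bool) i = false} F →* Fˣ).comp (Pi.evalMonoidHom (fun t : Bool => GL {i : Fin 3 // (![false, false, true] : Fin 3 → Bool) i = t} F) false)) * (a).comp ((Matrix.GeneralLinearGroup.det : GL {i : Fin 3 // (![false, false, true] : Fin 3 → Bool) i = true} F →* Fˣ).comp (Pi.evalMonoidHom (fun t : Bool => GL {i : Fin 3 // (![false, false, true] : Fin 3 → Bool) i = t} F) true)))))).Coinvariants]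
    (hD' : ∀ ζ : (Π t : Fin 3, GL {i : Fin 3 // (id : Fin 3 → Fin 3) i = t} F) → ℂ, finrank ℂ ↥(⨅ m, Module.End.maxGenEigenspace (Representation.normalizedJacquetGL F (id : Fin 3 → Fin 3) (Representation.parabolicIndGL F (![false, false, true] : Fin 3 → Bool) ((Representation.trivial ℂ (Π t : Bool, GL {i : Fin 3 // (![false, false, true] : Fin 3 → Bool) i = t} F) ℂ).twist ((a * ((unramifiedTwist F 1 : QuasiChar F).toMonoidHom) * ((unramifiedTwist F (1 / 2) : QuasiChar F).toMonoidHom)).comp ((Matrix.GeneralLinearGroup.det : GL {i : Fin 3 // (![false, false, true] : Fin 3 → Bool) i = false} F →* Fˣ).comp (Pi.evalMonoidHom (fun t : Bool => GL {i : Fin 3 // (![false, false, true] : Fin 3 → Bool) i = t} F) false)) * (a).comp ((Matrix.GeneralLinearGroup.det : GL {i : Fin 3 // (![false, false, true] : Fin 3 → Bool) i = true} F →* Fˣ).comp (Pi.evalMonoidHom (fun t : Bool => GL {i : Fin 3 // (![false, false, true] : Fin 3 → Bool) i = t} F) true))))) m) (ζ m)) =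
      (if ζ = (fun m : (Π t : Fin 3, GL {i : Fin 3 // (id : Fin 3 → Fin 3) i = t} F) => ((((∏ i : Fin 3, ((![a * ((unramifiedTwist F 1 : QuasiChar F).toMonoidHom), a * ((unramifiedTwist F 1 : QuasiChar F).toMonoidHom) * ((unramifiedTwist F 1 : QuasiChar F).toMonoidHom), a] : Fin 3 → (Fˣ →* ℂˣ)) i).comp (Matrix.GeneralLinearGroup.det.comp (Pi.evalMonoidHom (fun t : Fin 3 => GL {i : Fin 3 // (id : Fin 3 → Fin 3) i = t} F) i)))) m : ℂˣ) : ℂ)) then 1 else 0) + (if ζ = (fun m : (Π t : Fin 3, GL {i : Fin 3 // (id : Fin 3 → Fin 3) i = t} F) => ((((∏ i : Fin 3, ((![a * ((unramifiedTwist F 1 : QuasiChar F).toMonoidHom), a, a * ((unramifiedTwist F 1 : QuasiChar F).toMonoidHom) * ((unramifiedTwist F 1 : QuasiChar F).toMonoidHom)] : Fin 3 → (Fˣ →* ℂˣ)) i).comp (Matrix.GeneralLinearGroup.det.comp (Pi.evalMonoidHom (fun t : Fin 3 => GL {i : Fin 3 // (id : Fin 3 → Fin 3) i = t} F) i)))) m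 : ℂˣ) : ℂ)) then 1 else 0) + (if ζ = (fun m : (Π t : Fin 3, GL {i : Fin 3 // (id : Fin 3 → Fin 3) i = t} F) => ((((∏ i : Fin 3, ((![a, a * ((unramifiedTwist F 1 : QuasiChar F).toMonoidHom), a * ((unramifiedTwist F 1 : QuasiChar F).toMonoidHom) * ((unramifiedTwist F 1 : QuasiChar F).toMonoidHom)] : Fin 3 → (Fˣ →* ℂˣ)) i).comp (Matrix.GeneralLinearGroup.det.comp (Pi.evalMonoidHom (fun t : Fin 3 => GL {i : Fin 3 // (id : Fin 3 → Fin 3) i = t} F) i)))) m : ℂˣ) : ℂ)) then 1 else 0))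
    (hS₁₂ : ∀ {Y : Type} [AddCommGroup Y] [Module ℂ Y] (V : Representation ℂ (GL (Fin 3) F) Y), V.IsSmooth → ∀ [FiniteDimensional ℂ (Representation.restrictUnipotentGL F (id : Fin 3 → Fin 3) V).Coinvariants],
      finrank ℂ ↥(⨅ m, Module.End.maxGenEigenspace (Representation.normalizedJacquetGL F (id : Fin 3 → Fin 3) V m) (((((∏ i : Fin 3, ((![a * ((unramifiedTwist F 1 : QuasiChar F).toMonoidHom), a, a * ((unramifiedTwist F 1 : QuasiChar F).toMonoidHom) * ((unramifiedTwist F 1 : QuasiChar F).toMonoidHom)] : Fin 3 → (Fˣ →* ℂˣ)) i).comp (Matrix.GeneralLinearGroup.det.comp (Pi.evalMonoidHom (fun t : Fin 3 => GL {i : Fin 3 // (id : Fin 3 → Fin 3) i = t} F) i)))) m : ℂˣ) : ℂ))) =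
        finrank ℂ ↥(⨅ m, Module.End.maxGenEigenspace (Representation.normalizedJacquetGL F (id : Fin 3 → Fin 3) V m) (((((∏ i : Fin 3, ((![a * ((unramifiedTwist F 1 : QuasiChar F).toMonoidHom), a * ((unramifiedTwist F 1 : QuasiChar F).toMonoidHom) * ((unramifiedTwist F 1 : QuasiChar F).toMonoidHom), a] : Fin 3 → (Fˣ →* ℂˣ)) i).comp (Matrix.GeneralLinearGroup.det.comp (Pi.evalMonoidHom (fun t : Fin 3 => GL {i : Fin 3 // (id : Fin 3 → Fin 3) i = t} F) i)))) m : ℂˣ) : ℂ)))) {Y : Type} [AddCommGroup Y] [Module ℂ Y] (W : Representation ℂ (GL (Fin 3) F) Y) [W.IsIrreducible] (hW : W.IsSmooth)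
    [FiniteDimensional ℂ (Representation.restrictUnipotentGL F (id : Fin 3 → Fin 3) W).Coinvariants]
    (h : finrank ℂ ↥(⨅ m, Module.End.maxGenEigenspace (Representation.normalizedJacquetGL F (id : Fin 3 → Fin 3) W m) (((((∏ i : Fin 3, ((![a * ((unramifiedTwist F 1 : QuasiChar F).toMonoidHom), a, a * ((unramifiedTwist F 1 : QuasiChar F).toMonoidHom) * ((unramifiedTwist F 1 : QuasiChar F).toMonoidHom)] : Fin 3 → (Fˣ →* ℂˣ)) i).comp (Matrix.GeneralLinearGroup.det.comp (Pi.evalMonoidHom (fun t : Fin 3 => GL {i : Fin 3 // (id : Fin 3 → Fin 3) i = t} F) i)))) m : ℂˣ) : ℂ))) ≠ 0 ∨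
      finrank ℂ ↥(⨅ m, Module.End.maxGenEigenspace (Representation.normalizedJacquetGL F (id : Fin 3 → Fin 3) W m) (((((∏ i : Fin 3, ((![a * ((unramifiedTwist F 1 : QuasiChar F).toMonoidHom), a * ((unramifiedTwist F 1 : QuasiChar F).toMonoidHom) * ((unramifiedTwist F 1 : QuasiChar F).toMonoidHom), a] : Fin 3 → (Fˣ →* ℂˣ)) i).comp (Matrix.GeneralLinearGroup.det.comp (Pi.evalMonoidHom (fun t : Fin 3 => GL {i : Fin 3 // (id : Fin 3 → Fin 3) i = t} F) i)))) m : ℂˣ) : ℂ))) ≠ 0) :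
    finrank ℂ ↥(⨅ m, Module.End.maxGenEigenspace (Representation.normalizedJacquetGL F (id : Fin 3 → Fin 3) W m) (((((∏ i : Fin 3, ((![a * ((unramifiedTwist F 1 : QuasiChar F).toMonoidHom), a, a * ((unramifiedTwist F 1 : QuasiChar F).toMonoidHom) * ((unramifiedTwist F 1 : QuasiChar F).toMonoidHom)] : Fin 3 → (Fˣ →* ℂˣ)) i).comp (Matrix.GeneralLinearGroup.det.comp (Pi.evalMonoidHom (fun t : Fin 3 => GL {i : Fin 3 // (id : Fin 3 → Fin 3) i = t} F) i)))) m : ℂˣ) : ℂ))) = 1 ∧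
    finrank ℂ ↥(⨅ m, Module.End.maxGenEigenspace (Representation.normalizedJacquetGL F (id : Fin 3 → Fin 3) W m) (((((∏ i : Fin 3, ((![a * ((unramifiedTwist F 1 : QuasiChar F).toMonoidHom), a * ((unramifiedTwist F 1 : QuasiChar F).toMonoidHom) * ((unramifiedTwist F 1 : QuasiChar F).toMonoidHom), a] : Fin 3 → (Fˣ →* ℂˣ)) i).comp (Matrix.GeneralLinearGroup.det.comp (Pi.evalMonoidHom (fun t : Fin 3 => GL {i : Fin 3 // (id : Fin 3 → Fin 3) i = t} F) i)))) m : ℂˣ) : ℂ))) = 1 ∧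
    ∀ ζ : (Π t : Fin 3, GL {i : Fin 3 // (id : Fin 3 → Fin 3) i = t} F) → ℂ, ζ ≠ (fun m : (Π t : Fin 3, GL {i : Fin 3 // (id : Fin 3 → Fin 3) i = t} F) => ((((∏ i : Fin 3, ((![a * ((unramifiedTwist F 1 : QuasiChar F).toMonoidHom), a, a * ((unramifiedTwist F 1 : QuasiChar F).toMonoidHom) * ((unramifiedTwist F 1 : QuasiChar F).toMonoidHom)] : Fin 3 → (Fˣ →* ℂˣ)) i).comp (Matrix.GeneralLinearGroup.det.comp (Pi.evalMonoidHom (fun t : Fin 3 => GL {i : Fin 3 // (id : Fin 3 → Fin 3) i = t} F) i)))) m : ℂˣ) : ℂ)) → ζ ≠ (fun m : (Π t : Fin 3, GL {i : Fin 3 // (id : Fin 3 → Fin 3) i = t} F) => ((((∏ i : Fin 3, ((![a * ((unramifiedTwist F 1 : QuasiChar F).toMonoidHom), a * ((unramifiedTwist F 1 : QuasiChar F).toMonoidHom) * ((unramifiedTwist F 1 : QuasiChar F).toMonoidHom), a] : Fin 3 → (Fˣ →* ℂˣ)) i).comp (Matrix.GeneralLinearGroup.det.comp (Pi.evalMonoidHom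 (fun t : Fin 3 => GL {i : Fin 3 // (id : Fin 3 → Fin 3) i = t} F) i)))) m : ℂˣ) : ℂ)) →
      finrank ℂ ↥(⨅ m, Module.End.maxGenEigenspace (Representation.normalizedJacquetGL F (id : Fin 3 → Fin 3) W m) (ζ m)) = 0 := by
  have h_ob := cube_letters_ne a
  obtain ⟨h1, h2, h3, -⟩ := h_ob
  have n4p4 : (fun m : (Π t : Fin 3, GL {i : Fin 3 // (id : Fin 3 → Fin 3) i = t} F) => ((((∏ i : Fin 3, ((![a * ((unramifiedTwist F 1 : QuasiChar F).toMonoidHom), a * ((unramifiedTwist F 1 : QuasiChar F).toMonoidHom) * ((unramifiedTwist F 1 : QuasiChar F).toMonoidHom), a] : Fin 3 → (Fˣ →* ℂˣ)) i).comp (Matrix.GeneralLinearGroup.det.comp (Pi.evalMonoidHom (fun t : Fin 3 => GL {i : Fin 3 // (id : Fin 3 → Fin 3) i = t} F) i)))) m : ℂˣ) : ℂ)) ≠ (fun m : (Π t : Fin 3, GL {i : Fin 3 // (id : Fin 3 → Fin 3) i = t} F) => ((((∏ i : Fin 3, ((![a * ((unramifiedTwist F 1 : QuasiChar F).toMonoidHom),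 a, a * ((unramifiedTwist F 1 : QuasiChar F).toMonoidHom) * ((unramifiedTwist F 1 : QuasiChar F).toMonoidHom)] : Fin 3 → (Fˣ →* ℂˣ)) i).comp (Matrix.GeneralLinearGroup.det.comp (Pi.evalMonoidHom (fun t : Fin 3 => GL {i : Fin 3 // (id : Fin 3 → Fin 3) i = t} F) i)))) m : ℂˣ) : ℂ)) := wt_ne_of_apply_ne _ _ 1 (by simpa using h2)
  have n4p1 : (fun m : (Π t : Fin 3, GL {i : Fin 3 // (id : Fin 3 → Fin 3) i = t} F) => ((((∏ i : Fin 3, ((![a * ((unramifiedTwist F 1 : QuasiChar F).toMonoidHom), a * ((unramifiedTwist F 1 : QuasiChar F).toMonoidHom) * ((unramifiedTwist F 1 : QuasiChar F).toMonoidHom), a] : Fin 3 → (Fˣ →* ℂˣ)) i).comp (Matrix.GeneralLinearGroup.det.comp (Pi.evalMonoidHom (fun t : Fin 3 => GL {i : Fin 3 // (id : Fin 3 → Fin 3) i = t} F) i)))) m : ℂˣ) : ℂ)) ≠ (fun m : (Π t : Fin 3, GL {i : Fin 3 // (id : Fin 3 → Fin 3) i = t} F) => ((((∏ i : Fin 3,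 ((![a, a * ((unramifiedTwist F 1 : QuasiChar F).toMonoidHom), a * ((unramifiedTwist F 1 : QuasiChar F).toMonoidHom) * ((unramifiedTwist F 1 : QuasiChar F).toMonoidHom)] : Fin 3 → (Fˣ →* ℂˣ)) i).comp (Matrix.GeneralLinearGroup.det.comp (Pi.evalMonoidHom (fun t : Fin 3 => GL {i : Fin 3 // (id : Fin 3 → Fin 3) i = t} F) i)))) m : ℂˣ) : ℂ)) := wt_ne_of_apply_ne _ _ 0 (by simpa using h1)
  have n41 : (fun m : (Π t : Fin 3, GL {i : Fin 3 // (id : Fin 3 → Fin 3) i = t} F) => ((((∏ i : Fin 3, ((![a * ((unramifiedTwist F 1 : QuasiChar F).toMonoidHom), a, a * ((unramifiedTwist F 1 : QuasiChar F).toMonoidHom) * ((unramifiedTwist F 1 : QuasiChar F).toMonoidHom)] : Fin 3 → (Fˣ →* ℂˣ)) i).comp (Matrix.GeneralLinearGroup.det.comp (Pi.evalMonoidHom (fun t : Fin 3 => GL {i : Fin 3 // (id : Fin 3 → Fin 3) i = t} F) i)))) m : ℂˣ) : ℂ)) ≠ (fun m : (Π t : Fin 3, GL {i : Fin 3 // (id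 : Fin 3 → Fin 3) i = t} F) => ((((∏ i : Fin 3, ((![a, a * ((unramifiedTwist F 1 : QuasiChar F).toMonoidHom), a * ((unramifiedTwist F 1 : QuasiChar F).toMonoidHom) * ((unramifiedTwist F 1 : QuasiChar F).toMonoidHom)] : Fin 3 → (Fˣ →* ℂˣ)) i).comp (Matrix.GeneralLinearGroup.det.comp (Pi.evalMonoidHom (fun t : Fin 3 => GL {i : Fin 3 // (id : Fin 3 → Fin 3) i = t} F) i)))) m : ℂˣ) : ℂ)) := wt_ne_of_apply_ne _ _ 0 (by simpa using h1)
  have h4p : finrank ℂ ↥(⨅ m, Module.End.maxGenEigenspace (Representation.normalizedJacquetGL F (id : Fin 3 → Fin 3) W m) (((((∏ i : Fin 3, ((![a * ((unramifiedTwist F 1 : QuasiChar F).toMonoidHom), a * ((unramifiedTwist F 1 : QuasiChar F).toMonoidHom) * ((unramifiedTwist F 1 : QuasiChar F).toMonoidHom), a] : Fin 3 → (Fˣ →* ℂˣ)) i).comp (Matrix.GeneralLinearGroup.det.comp (Pi.evalMonoidHom (fun t : Fin 3 => GL {i : Fin 3 // (id : Fin 3 → Fin 3) i = t} F) i)))) m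 : ℂˣ) : ℂ))) ≠ 0 := by
    rcases h with h | h
    · rwa [← hS₁₂ W hW]
    · exact h
  have h4 : finrank ℂ ↥(⨅ m, Module.End.maxGenEigenspace (Representation.normalizedJacquetGL F (id : Fin 3 → Fin 3) W m) (((((∏ i : Fin 3, ((![a * ((unramifiedTwist F 1 : QuasiChar F).toMonoidHom), a, a * ((unramifiedTwist F 1 : QuasiChar F).toMonoidHom) * ((unramifiedTwist F 1 : QuasiChar F).toMonoidHom)] : Fin 3 → (Fˣ →* ℂˣ)) i).comp (Matrix.GeneralLinearGroup.det.comp (Pi.evalMonoidHom (fun t : Fin 3 => GL {i : Fin 3 // (id : Fin 3 → Fin 3) i = t} F) i)))) m : ℂˣ) : ℂ))) ≠ 0 := by rwa [hS₁₂ W hW]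
  have hD's := (isAdmissible_D'_cube a ha).isSmooth
  have h_ob := exists_injective_intertwiningMap_D'_of_weight_C₄ a ha hD' hS₁₂ W hW h
  obtain ⟨Λ, hΛ⟩ := h_ob
  have hle := fun ζ => finrank_weightSpace_le_of_injective (Representation.parabolicIndGL F (![false, false, true] : Fin 3 → Bool) ((Representation.trivial ℂ (Π t : Bool, GL {i : Fin 3 // (![false, false, true] : Fin 3 → Bool) i = t} F) ℂ).twist ((a * ((unramifiedTwist F 1 : QuasiChar F).toMonoidHom) * ((unramifiedTwist F (1 / 2) : QuasiChar F).toMonoidHom)).comp ((Matrix.GeneralLinearGroup.det : GL {i : Fin 3 // (![false, false, true] : Fin 3 → Bool) i = false} F →* Fˣ).comp (Pi.evalMonoidHom (fun t : Bool => GL {i : Fin 3 // (![false, false, true] : Fin 3 → Bool) i = t} F) false)) * (a).comp ((Matrix.GeneralLinearGroup.det : GL {i : Fin 3 // (![false, false, true] : Fin 3 → Bool) i = true} F →* Fˣ).comp (Pi.evalMonoidHom (fun t : Bool => GL {i : Fin 3 // (![false, false, true] : Fin 3 → Bool) i = t} F) true))))) W hD's Λ hΛ ζ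
  have h_ob := table_D' a hD'
  obtain ⟨hD4p, hD4, hD1, hD0⟩ := h_ob
  have h4pos := Nat.pos_of_ne_zero h4
  have h4ppos := Nat.pos_of_ne_zero h4p
  have hW1 : finrank ℂ ↥(⨅ m, Module.End.maxGenEigenspace (Representation.normalizedJacquetGL F (id : Fin 3 → Fin 3) W m) (((((∏ i : Fin 3, ((![a, a * ((unramifiedTwist F 1 : QuasiChar F).toMonoidHom), a * ((unramifiedTwist F 1 : QuasiChar F).toMonoidHom) * ((unramifiedTwist F 1 : QuasiChar F).toMonoidHom)] : Fin 3 → (Fˣ →* ℂˣ)) i).comp (Matrix.GeneralLinearGroup.det.comp (Pi.evalMonoidHom (fun t : Fin 3 => GL {i : Fin 3 // (id : Fin 3 → Fin 3) i = t} F) i)))) m : ℂˣ) : ℂ))) = 0 := by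
    by_contra hne
    have h_ob := nonempty_equiv_pi_of_weight_C₁ a ha W hW hne
    obtain ⟨e⟩ := h_ob
    exact h4 ((finrank_weightSpace_eq_of_equiv _ _ e _).trans (finrank_weightSpace_pi_cube_eq_zero a _ n41))
  refine ⟨?_, ?_, fun ζ hζ hζ' => ?_⟩
  · have := hle (fun m : (Π t : Fin 3, GL {i : Fin 3 // (id : Fin 3 → Fin 3) i = t} F) => ((((∏ i : Fin 3, ((![a * ((unramifiedTwist F 1 : QuasiChar F).toMonoidHom), a, a * ((unramifiedTwist F 1 : QuasiChar F).toMonoidHom) * ((unramifiedTwist F 1 : QuasiChar F).toMonoidHom)] : Fin 3 → (Fˣ →* ℂˣ)) i).comp (Matrix.GeneralLinearGroup.det.comp (Pi.evalMonoidHom (fun t : Fin 3 => GL {i : Fin 3 // (id : Fin 3 → Fin 3) i = t} F) i)))) m : ℂˣ) : ℂ))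
    linarith
  · have := hle (fun m : (Π t : Fin 3, GL {i : Fin 3 // (id : Fin 3 → Fin 3) i = t} F) => ((((∏ i : Fin 3, ((![a * ((unramifiedTwist F 1 : QuasiChar F).toMonoidHom), a * ((unramifiedTwist F 1 : QuasiChar F).toMonoidHom) * ((unramifiedTwist F 1 : QuasiChar F).toMonoidHom), a] : Fin 3 → (Fˣ →* ℂˣ)) i).comp (Matrix.GeneralLinearGroup.det.comp (Pi.evalMonoidHom (fun t : Fin 3 => GL {i : Fin 3 // (id : Fin 3 → Fin 3) i = t} F) i)))) m : ℂˣ) : ℂ))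
    linarith
  · by_cases hζ1 : ζ = (fun m : (Π t : Fin 3, GL {i : Fin 3 // (id : Fin 3 → Fin 3) i = t} F) => ((((∏ i : Fin 3, ((![a, a * ((unramifiedTwist F 1 : QuasiChar F).toMonoidHom), a * ((unramifiedTwist F 1 : QuasiChar F).toMonoidHom) * ((unramifiedTwist F 1 : QuasiChar F).toMonoidHom)] : Fin 3 → (Fˣ →* ℂˣ)) i).comp (Matrix.GeneralLinearGroup.det.comp (Pi.evalMonoidHom (fun t : Fin 3 => GL {i : Fin 3 // (id : Fin 3 → Fin 3) i = t} F) i)))) m : ℂˣ) : ℂ))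
    · rw [hζ1]; exact hW1
    · have := hD0 ζ hζ' hζ hζ1
      have := hle ζ
      linarith

/-! ## §2 The quotient `D′ ⁄ Λ(W)` and `tr W = tr D′ − tr π₁` -/

include ha in
/-- **Weights of `Q := D′ ⁄ Λ(W)`** for an injective `Λ : W → D′` (`W` irreducible smooth with a C₄-class weight): `mult Q (wt C₁) = 1` and `mult Q ζ = 0` otherwise
(★ ADD additivity along `Λ(W) ≤ D′`, `Λ(W) ≅ W`, `E(W) = {C₄, C₄′}`, the table `hD′`). [cite: Zelevinsky1980, Thm. 6.1, §9] [cite: BernsteinZelevinsky1977, §2.3] -/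
theorem weights_quotient_D' [FiniteDimensional ℂ (Representation.restrictUnipotentGL F (id : Fin 3 → Fin 3) (Representation.parabolicIndGL F (![false, false, true] : Fin 3 → Bool) ((Representation.trivial ℂ (Π t : Bool, GL {i : Fin 3 // (![false, false, true] : Fin 3 → Bool) i = t} F) ℂ).twist ((a * ((unramifiedTwist F 1 : QuasiChar F).toMonoidHom) * ((unramifiedTwist F (1 / 2) : QuasiChar F).toMonoidHom)).comp ((Matrix.GeneralLinearGroup.det : GL {i : Fin 3 // (![false, false, true] : Fin 3 → Bool) i = false} F →* Fˣ).comp (Pi.evalMonoidHom (fun t : Bool => GL {i : Fin 3 // (![false, false, true] : Fin 3 → Bool) i = t} F) false)) * (a).comp ((Matrix.GeneralLinearGroup.det : GL {i : Fin 3 // (![false, false, true] : Fin 3 → Bool) i = true} F →* Fˣ).comp (Pi.evalMonoidHom (fun t : Bool => GL {i : Fin 3 // (![false, false, true] : Fin 3 → Bool) i = t} F) true)))))).Coinvariants]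
    (hD' : ∀ ζ : (Π t : Fin 3, GL {i : Fin 3 // (id : Fin 3 → Fin 3) i = t} F) → ℂ, finrank ℂ ↥(⨅ m, Module.End.maxGenEigenspace (Representation.normalizedJacquetGL F (id : Fin 3 → Fin 3) (Representation.parabolicIndGL F (![false, false, true] : Fin 3 → Bool) ((Representation.trivial ℂ (Π t : Bool, GL {i : Fin 3 // (![false, false, true] : Fin 3 → Bool) i = t} F) ℂ).twist ((a * ((unramifiedTwist F 1 : QuasiChar F).toMonoidHom) * ((unramifiedTwist F (1 / 2) : QuasiChar F).toMonoidHom)).comp ((Matrix.GeneralLinearGroup.det : GL {i : Fin 3 // (![false, false, true] : Fin 3 → Bool) i = false} F →* Fˣ).comp (Pi.evalMonoidHom (fun t : Bool => GL {i : Fin 3 // (![false, false, true] : Fin 3 → Bool) i = t} F) false)) * (a).comp ((Matrix.GeneralLinearGroup.det : GL {i : Fin 3 // (![false, false, true] : Fin 3 → Bool) i = true} F →* Fˣ).comp (Pi.evalMonoidHom (fun t : Bool => GL {i : Fin 3 // (![false, false, true] : Fin 3 → Bool) i = t} F) true))))) m) (ζ m)) =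
      (if ζ = (fun m : (Π t : Fin 3, GL {i : Fin 3 // (id : Fin 3 → Fin 3) i = t} F) => ((((∏ i : Fin 3, ((![a * ((unramifiedTwist F 1 : QuasiChar F).toMonoidHom), a * ((unramifiedTwist F 1 : QuasiChar F).toMonoidHom) * ((unramifiedTwist F 1 : QuasiChar F).toMonoidHom), a] : Fin 3 → (Fˣ →* ℂˣ)) i).comp (Matrix.GeneralLinearGroup.det.comp (Pi.evalMonoidHom (fun t : Fin 3 => GL {i : Fin 3 // (id : Fin 3 → Fin 3) i = t} F) i)))) m : ℂˣ) : ℂ)) then 1 else 0) + (if ζ = (fun m : (Π t : Fin 3, GL {i : Fin 3 // (id : Fin 3 → Fin 3) i = t} F) => ((((∏ i : Fin 3, ((![a * ((unramifiedTwist F 1 : QuasiChar F).toMonoidHom), a, a * ((unramifiedTwist F 1 : QuasiChar F).toMonoidHom) * ((unramifiedTwist F 1 : QuasiChar F).toMonoidHom)] : Fin 3 → (Fˣ →* ℂˣ)) i).comp (Matrix.GeneralLinearGroup.det.comp (Pi.evalMonoidHom (fun t : Fin 3 => GL {i : Fin 3 // (id : Fin 3 → Fin 3) i = t} F) i)))) m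 : ℂˣ) : ℂ)) then 1 else 0) + (if ζ = (fun m : (Π t : Fin 3, GL {i : Fin 3 // (id : Fin 3 → Fin 3) i = t} F) => ((((∏ i : Fin 3, ((![a, a * ((unramifiedTwist F 1 : QuasiChar F).toMonoidHom), a * ((unramifiedTwist F 1 : QuasiChar F).toMonoidHom) * ((unramifiedTwist F 1 : QuasiChar F).toMonoidHom)] : Fin 3 → (Fˣ →* ℂˣ)) i).comp (Matrix.GeneralLinearGroup.det.comp (Pi.evalMonoidHom (fun t : Fin 3 => GL {i : Fin 3 // (id : Fin 3 → Fin 3) i = t} F) i)))) m : ℂˣ) : ℂ)) then 1 else 0))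
    (hS₁₂ : ∀ {Y : Type} [AddCommGroup Y] [Module ℂ Y] (V : Representation ℂ (GL (Fin 3) F) Y), V.IsSmooth → ∀ [FiniteDimensional ℂ (Representation.restrictUnipotentGL F (id : Fin 3 → Fin 3) V).Coinvariants],
      finrank ℂ ↥(⨅ m, Module.End.maxGenEigenspace (Representation.normalizedJacquetGL F (id : Fin 3 → Fin 3) V m) (((((∏ i : Fin 3, ((![a * ((unramifiedTwist F 1 : QuasiChar F).toMonoidHom), a, a * ((unramifiedTwist F 1 : QuasiChar F).toMonoidHom) * ((unramifiedTwist F 1 : QuasiChar F).toMonoidHom)] : Fin 3 → (Fˣ →* ℂˣ)) i).comp (Matrix.GeneralLinearGroup.det.comp (Pi.evalMonoidHom (fun t : Fin 3 => GL {i : Fin 3 // (id : Fin 3 → Fin 3) i = t} F) i)))) m : ℂˣ) : ℂ))) =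
        finrank ℂ ↥(⨅ m, Module.End.maxGenEigenspace (Representation.normalizedJacquetGL F (id : Fin 3 → Fin 3) V m) (((((∏ i : Fin 3, ((![a * ((unramifiedTwist F 1 : QuasiChar F).toMonoidHom), a * ((unramifiedTwist F 1 : QuasiChar F).toMonoidHom) * ((unramifiedTwist F 1 : QuasiChar F).toMonoidHom), a] : Fin 3 → (Fˣ →* ℂˣ)) i).comp (Matrix.GeneralLinearGroup.det.comp (Pi.evalMonoidHom (fun t : Fin 3 => GL {i : Fin 3 // (id : Fin 3 → Fin 3) i = t} F) i)))) m : ℂˣ) : ℂ)))) {Y : Type} [AddCommGroup Y] [Module ℂ Y] (W : Representation ℂ (GL (Fin 3) F) Y) [W.IsIrreducible] (hW : W.IsSmooth)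
    [FiniteDimensional ℂ (Representation.restrictUnipotentGL F (id : Fin 3 → Fin 3) W).Coinvariants]
    (h : finrank ℂ ↥(⨅ m, Module.End.maxGenEigenspace (Representation.normalizedJacquetGL F (id : Fin 3 → Fin 3) W m) (((((∏ i : Fin 3, ((![a * ((unramifiedTwist F 1 : QuasiChar F).toMonoidHom), a, a * ((unramifiedTwist F 1 : QuasiChar F).toMonoidHom) * ((unramifiedTwist F 1 : QuasiChar F).toMonoidHom)] : Fin 3 → (Fˣ →* ℂˣ)) i).comp (Matrix.GeneralLinearGroup.det.comp (Pi.evalMonoidHom (fun t : Fin 3 => GL {i : Fin 3 // (id : Fin 3 → Fin 3) i = t} F) i)))) m : ℂˣ) : ℂ))) ≠ 0 ∨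
      finrank ℂ ↥(⨅ m, Module.End.maxGenEigenspace (Representation.normalizedJacquetGL F (id : Fin 3 → Fin 3) W m) (((((∏ i : Fin 3, ((![a * ((unramifiedTwist F 1 : QuasiChar F).toMonoidHom), a * ((unramifiedTwist F 1 : QuasiChar F).toMonoidHom) * ((unramifiedTwist F 1 : QuasiChar F).toMonoidHom), a] : Fin 3 → (Fˣ →* ℂˣ)) i).comp (Matrix.GeneralLinearGroup.det.comp (Pi.evalMonoidHom (fun t : Fin 3 => GL {i : Fin 3 // (id : Fin 3 → Fin 3) i = t} F) i)))) m : ℂˣ) : ℂ))) ≠ 0)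
    (Λ : W.IntertwiningMap (Representation.parabolicIndGL F (![false, false, true] : Fin 3 → Bool) ((Representation.trivial ℂ (Π t : Bool, GL {i : Fin 3 // (![false, false, true] : Fin 3 → Bool) i = t} F) ℂ).twist ((a * ((unramifiedTwist F 1 : QuasiChar F).toMonoidHom) * ((unramifiedTwist F (1 / 2) : QuasiChar F).toMonoidHom)).comp ((Matrix.GeneralLinearGroup.det : GL {i : Fin 3 // (![false, false, true] : Fin 3 → Bool) i = false} F →* Fˣ).comp (Pi.evalMonoidHom (fun t : Bool => GL {i : Fin 3 // (![false, false, true] : Fin 3 → Bool) i = t} F) false)) * (a).comp ((Matrix.GeneralLinearGroup.det : GL {i : Fin 3 // (![false, false, true] : Fin 3 → Bool) i = true} F →* Fˣ).comp (Pi.evalMonoidHom (fun t : Bool => GL {i : Fin 3 // (![false, false, true] : Fin 3 → Bool) i = t} F) true)))))) (hΛ : Function.Injective Λ) :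
    finrank ℂ ↥(⨅ m, Module.End.maxGenEigenspace (Representation.normalizedJacquetGL F (id : Fin 3 → Fin 3) Λ.range.quotientRep m) (((((∏ i : Fin 3, ((![a, a * ((unramifiedTwist F 1 : QuasiChar F).toMonoidHom), a * ((unramifiedTwist F 1 : QuasiChar F).toMonoidHom) * ((unramifiedTwist F 1 : QuasiChar F).toMonoidHom)] : Fin 3 → (Fˣ →* ℂˣ)) i).comp (Matrix.GeneralLinearGroup.det.comp (Pi.evalMonoidHom (fun t : Fin 3 => GL {i : Fin 3 // (id : Fin 3 → Fin 3) i = t} F) i)))) m : ℂˣ) : ℂ))) = 1 ∧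
    ∀ ζ : (Π t : Fin 3, GL {i : Fin 3 // (id : Fin 3 → Fin 3) i = t} F) → ℂ, ζ ≠ (fun m : (Π t : Fin 3, GL {i : Fin 3 // (id : Fin 3 → Fin 3) i = t} F) => ((((∏ i : Fin 3, ((![a, a * ((unramifiedTwist F 1 : QuasiChar F).toMonoidHom), a * ((unramifiedTwist F 1 : QuasiChar F).toMonoidHom) * ((unramifiedTwist F 1 : QuasiChar F).toMonoidHom)] : Fin 3 → (Fˣ →* ℂˣ)) i).comp (Matrix.GeneralLinearGroup.det.comp (Pi.evalMonoidHom (fun t : Fin 3 => GL {i : Fin 3 // (id : Fin 3 → Fin 3) i = t} F) i)))) m : ℂˣ) : ℂ)) →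
      finrank ℂ ↥(⨅ m, Module.End.maxGenEigenspace (Representation.normalizedJacquetGL F (id : Fin 3 → Fin 3) Λ.range.quotientRep m) (ζ m)) = 0 := by
  have h_ob := cube_letters_ne a
  obtain ⟨h1, h2, h3, -⟩ := h_ob
  have n4p4 : (fun m : (Π t : Fin 3, GL {i : Fin 3 // (id : Fin 3 → Fin 3) i = t} F) => ((((∏ i : Fin 3, ((![a * ((unramifiedTwist F 1 : QuasiChar F).toMonoidHom), a * ((unramifiedTwist F 1 : QuasiChar F).toMonoidHom) * ((unramifiedTwist F 1 : QuasiChar F).toMonoidHom), a] : Fin 3 → (Fˣ →* ℂˣ)) i).comp (Matrix.GeneralLinearGroup.det.comp (Pi.evalMonoidHom (fun t : Fin 3 => GL {i : Fin 3 // (id : Fin 3 → Fin 3) i = t} F) i)))) m : ℂˣ) : ℂ)) ≠ (fun m : (Π t : Fin 3, GL {i : Fin 3 // (id : Fin 3 → Fin 3) i = t} F) => ((((∏ i : Fin 3, ((![a * ((unramifiedTwist F 1 : QuasiChar F).toMonoidHom), a, a * ((unramifiedTwist F 1 : QuasiChar F).toMonoidHom) * ((unramifiedTwist F 1 : QuasiChar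 F).toMonoidHom)] : Fin 3 → (Fˣ →* ℂˣ)) i).comp (Matrix.GeneralLinearGroup.det.comp (Pi.evalMonoidHom (fun t : Fin 3 => GL {i : Fin 3 // (id : Fin 3 → Fin 3) i = t} F) i)))) m : ℂˣ) : ℂ)) := wt_ne_of_apply_ne _ _ 1 (by simpa using h2)
  have n4p1 : (fun m : (Π t : Fin 3, GL {i : Fin 3 // (id : Fin 3 → Fin 3) i = t} F) => ((((∏ i : Fin 3, ((![a * ((unramifiedTwist F 1 : QuasiChar F).toMonoidHom), a * ((unramifiedTwist F 1 : QuasiChar F).toMonoidHom) * ((unramifiedTwist F 1 : QuasiChar F).toMonoidHom), a] : Fin 3 → (Fˣ →* ℂˣ)) i).comp (Matrix.GeneralLinearGroup.det.comp (Pi.evalMonoidHom (fun t : Fin 3 => GL {i : Fin 3 // (id : Fin 3 → Fin 3) i = t} F) i)))) m : ℂˣ) : ℂ)) ≠ (fun m : (Π t : Fin 3, GL {i : Fin 3 // (id : Fin 3 → Fin 3) i = t} F) => ((((∏ i : Fin 3, ((![a, a * ((unramifiedTwist F 1 : QuasiChar F).toMonoidHom), a * ((unramifiedTwist F 1 : QuasiChar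 F).toMonoidHom) * ((unramifiedTwist F 1 : QuasiChar F).toMonoidHom)] : Fin 3 → (Fˣ →* ℂˣ)) i).comp (Matrix.GeneralLinearGroup.det.comp (Pi.evalMonoidHom (fun t : Fin 3 => GL {i : Fin 3 // (id : Fin 3 → Fin 3) i = t} F) i)))) m : ℂˣ) : ℂ)) := wt_ne_of_apply_ne _ _ 0 (by simpa using h1)
  have n41 : (fun m : (Π t : Fin 3, GL {i : Fin 3 // (id : Fin 3 → Fin 3) i = t} F) => ((((∏ i : Fin 3, ((![a * ((unramifiedTwist F 1 : QuasiChar F).toMonoidHom), a, a * ((unramifiedTwist F 1 : QuasiChar F).toMonoidHom) * ((unramifiedTwist F 1 : QuasiChar F).toMonoidHom)] : Fin 3 → (Fˣ →* ℂˣ)) i).comp (Matrix.GeneralLinearGroup.det.comp (Pi.evalMonoidHom (fun t : Fin 3 => GL {i : Fin 3 // (id : Fin 3 → Fin 3) i = t} F) i)))) m : ℂˣ) : ℂ)) ≠ (fun m : (Π t : Fin 3, GL {i : Fin 3 // (id : Fin 3 → Fin 3) i = t} F) => ((((∏ i : Fin 3, ((![a, a * ((unramifiedTwist F 1 : QuasiChar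 F).toMonoidHom), a * ((unramifiedTwist F 1 : QuasiChar F).toMonoidHom) * ((unramifiedTwist F 1 : QuasiChar F).toMonoidHom)] : Fin 3 → (Fˣ →* ℂˣ)) i).comp (Matrix.GeneralLinearGroup.det.comp (Pi.evalMonoidHom (fun t : Fin 3 => GL {i : Fin 3 // (id : Fin 3 → Fin 3) i = t} F) i)))) m : ℂˣ) : ℂ)) := wt_ne_of_apply_ne _ _ 0 (by simpa using h1)
  have hD's := (isAdmissible_D'_cube a ha).isSmooth
  have h_ob := nonempty_equiv_range Λ hΛ
  obtain ⟨eW⟩ := h_ob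
  have h_ob := weights_of_weight_C₄ a ha hD' hS₁₂ W hW h
  obtain ⟨w4, w4p, w0⟩ := h_ob
  have hadd := fun ζ => finrank_weightSpace_eq_add_subrepresentation (Representation.parabolicIndGL F (![false, false, true] : Fin 3 → Bool) ((Representation.trivial ℂ (Π t : Bool, GL {i : Fin 3 // (![false, false, true] : Fin 3 → Bool) i = t} F) ℂ).twist ((a * ((unramifiedTwist F 1 : QuasiChar F).toMonoidHom) * ((unramifiedTwist F (1 / 2) : QuasiChar F).toMonoidHom)).comp ((Matrix.GeneralLinearGroup.det : GL {i : Fin 3 // (![false, false, true] : Fin 3 → Bool) i = false} F →* Fˣ).comp (Pi.evalMonoidHom (fun t : Bool => GL {i : Fin 3 // (![false, false, true] : Fin 3 → Bool) i = t} F) false)) * (a).comp ((Matrix.GeneralLinearGroup.det : GL {i : Fin 3 // (![false, false, true] : Fin 3 → Bool) i = true} F →* Fˣ).comp (Pi.evalMonoidHom (fun t : Bool => GL {i : Fin 3 // (![false, false, true] : Fin 3 → Bool) i = t} F) true))))) hD's Λ.range ζ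
  have hNW := fun ζ : (Π t : Fin 3, GL {i : Fin 3 // (id : Fin 3 → Fin 3) i = t} F) → ℂ => finrank_weightSpace_eq_of_equiv _ _ eW ζ
  have h_ob := table_D' a hD'
  obtain ⟨hD4p, hD4, hD1, hD0⟩ := h_ob
  refine ⟨?_, fun ζ hζ1 => ?_⟩
  · have e1 := hadd (fun m : (Π t : Fin 3, GL {i : Fin 3 // (id : Fin 3 → Fin 3) i = t} F) => ((((∏ i : Fin 3, ((![a, a * ((unramifiedTwist F 1 : QuasiChar F).toMonoidHom), a * ((unramifiedTwist F 1 : QuasiChar F).toMonoidHom) * ((unramifiedTwist F 1 : QuasiChar F).toMonoidHom)] : Fin 3 → (Fˣ →* ℂˣ)) i).comp (Matrix.GeneralLinearGroup.det.comp (Pi.evalMonoidHom (fun t : Fin 3 => GL {i : Fin 3 // (id : Fin 3 → Fin 3) i = t} F) i)))) m : ℂˣ) : ℂ))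
    have e2 := hNW (fun m : (Π t : Fin 3, GL {i : Fin 3 // (id : Fin 3 → Fin 3) i = t} F) => ((((∏ i : Fin 3, ((![a, a * ((unramifiedTwist F 1 : QuasiChar F).toMonoidHom), a * ((unramifiedTwist F 1 : QuasiChar F).toMonoidHom) * ((unramifiedTwist F 1 : QuasiChar F).toMonoidHom)] : Fin 3 → (Fˣ →* ℂˣ)) i).comp (Matrix.GeneralLinearGroup.det.comp (Pi.evalMonoidHom (fun t : Fin 3 => GL {i : Fin 3 // (id : Fin 3 → Fin 3) i = t} F) i)))) m : ℂˣ) : ℂ))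
    have e3 := w0 _ n41.symm n4p1.symm
    linarith only [e1, e2, e3, hD1]
  · have e1 := hadd ζ
    have e2 := hNW ζ
    by_cases hζ4 : ζ = (fun m : (Π t : Fin 3, GL {i : Fin 3 // (id : Fin 3 → Fin 3) i = t} F) => ((((∏ i : Fin 3, ((![a * ((unramifiedTwist F 1 : QuasiChar F).toMonoidHom), a, a * ((unramifiedTwist F 1 : QuasiChar F).toMonoidHom) * ((unramifiedTwist F 1 : QuasiChar F).toMonoidHom)] : Fin 3 → (Fˣ →* ℂˣ)) i).comp (Matrix.GeneralLinearGroup.det.comp (Pi.evalMonoidHom (fun t : Fin 3 => GL {i : Fin 3 // (id : Fin 3 → Fin 3) i = t} F) i)))) m : ℂˣ) : ℂ))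
    · subst hζ4; linarith only [e1, e2, hD4, w4]
    · by_cases hζ4p : ζ = (fun m : (Π t : Fin 3, GL {i : Fin 3 // (id : Fin 3 → Fin 3) i = t} F) => ((((∏ i : Fin 3, ((![a * ((unramifiedTwist F 1 : QuasiChar F).toMonoidHom), a * ((unramifiedTwist F 1 : QuasiChar F).toMonoidHom) * ((unramifiedTwist F 1 : QuasiChar F).toMonoidHom), a] : Fin 3 → (Fˣ →* ℂˣ)) i).comp (Matrix.GeneralLinearGroup.det.comp (Pi.evalMonoidHom (fun t : Fin 3 => GL {i : Fin 3 // (id : Fin 3 → Fin 3) i = t} F) i)))) m : ℂˣ) : ℂ))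
      · subst hζ4p; linarith only [e1, e2, hD4p, w4p]
      · have e3 := hD0 ζ hζ4p hζ4 hζ1
        have e4 := w0 ζ hζ4 hζ4p
        linarith only [e1, e2, e3, e4]

include ha in
/-- **`D′ ⁄ Λ(W) ≅ π₁`**: the quotient has the single weight `wt C₁` with multiplicity one, so it is irreducible (★ C2b-gen (I1), `hJ₄′` transported along `Q ↞ D′ ↪ I C₄′`) and
`≅ π₁` (★ C2b §1). [cite: Zelevinsky1980, Ex. 3.2, Thm. 6.1] [cite: BernsteinZelevinsky1977, Cor. 2.13] -/
theorem nonempty_equiv_pi_quotient_D' [FiniteDimensional ℂ (Representation.restrictUnipotentGL F (id : Fin 3 → Fin 3) (Representation.parabolicIndGL F (![false, false, true] : Fin 3 → Bool) ((Representation.trivial ℂ (Π t : Bool, GL {i : Fin 3 // (![false, false, true] : Fin 3 → Bool) i = t} F) ℂ).twist ((a * ((unramifiedTwist F 1 : QuasiChar F).toMonoidHom) * ((unramifiedTwist F (1 / 2) : QuasiChar F).toMonoidHom)).comp ((Matrix.GeneralLinearGroup.det : GL {i : Fin 3 // (![false, false, true] : Fin 3 → Bool) i = false} F →* Fˣ).comp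 (Pi.evalMonoidHom (fun t : Bool => GL {i : Fin 3 // (![false, false, true] : Fin 3 → Bool) i = t} F) false)) * (a).comp ((Matrix.GeneralLinearGroup.det : GL {i : Fin 3 // (![false, false, true] : Fin 3 → Bool) i = true} F →* Fˣ).comp (Pi.evalMonoidHom (fun t : Bool => GL {i : Fin 3 // (![false, false, true] : Fin 3 → Bool) i = t} F) true)))))).Coinvariants]
    (hD' : ∀ ζ : (Π t : Fin 3, GL {i : Fin 3 // (id : Fin 3 → Fin 3) i = t} F) → ℂ, finrank ℂ ↥(⨅ m, Module.End.maxGenEigenspace (Representation.normalizedJacquetGL F (id : Fin 3 → Fin 3) (Representation.parabolicIndGL F (![false, false, true] : Fin 3 → Bool) ((Representation.trivial ℂ (Π t : Bool, GL {i : Fin 3 // (![false, false, true] : Fin 3 → Bool) i = t} F) ℂ).twist ((a * ((unramifiedTwist F 1 : QuasiChar F).toMonoidHom) * ((unramifiedTwist F (1 / 2) : QuasiChar F).toMonoidHom)).comp ((Matrix.GeneralLinearGroup.det : GL {i : Fin 3 // (![false, false, true] : Fin 3 → Bool) i = false} F →* Fˣ).comp (Pi.evalMonoidHom (fun t : Bool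 => GL {i : Fin 3 // (![false, false, true] : Fin 3 → Bool) i = t} F) false)) * (a).comp ((Matrix.GeneralLinearGroup.det : GL {i : Fin 3 // (![false, false, true] : Fin 3 → Bool) i = true} F →* Fˣ).comp (Pi.evalMonoidHom (fun t : Bool => GL {i : Fin 3 // (![false, false, true] : Fin 3 → Bool) i = t} F) true))))) m) (ζ m)) =
      (if ζ = (fun m : (Π t : Fin 3, GL {i : Fin 3 // (id : Fin 3 → Fin 3) i = t} F) => ((((∏ i : Fin 3, ((![a * ((unramifiedTwist F 1 : QuasiChar F).toMonoidHom), a * ((unramifiedTwist F 1 : QuasiChar F).toMonoidHom) * ((unramifiedTwist F 1 : QuasiChar F).toMonoidHom), a] : Fin 3 → (Fˣ →* ℂˣ)) i).comp (Matrix.GeneralLinearGroup.det.comp (Pi.evalMonoidHom (fun t : Fin 3 => GL {i : Fin 3 // (id : Fin 3 → Fin 3) i = t} F) i)))) m : ℂˣ) : ℂ)) then 1 else 0) + (if ζ = (fun m : (Π t : Fin 3, GL {i : Fin 3 // (id : Fin 3 → Fin 3) i = t} F) => ((((∏ i : Fin 3, ((![a * ((unramifiedTwist F 1 : QuasiChar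 F).toMonoidHom), a, a * ((unramifiedTwist F 1 : QuasiChar F).toMonoidHom) * ((unramifiedTwist F 1 : QuasiChar F).toMonoidHom)] : Fin 3 → (Fˣ →* ℂˣ)) i).comp (Matrix.GeneralLinearGroup.det.comp (Pi.evalMonoidHom (fun t : Fin 3 => GL {i : Fin 3 // (id : Fin 3 → Fin 3) i = t} F) i)))) m : ℂˣ) : ℂ)) then 1 else 0) + (if ζ = (fun m : (Π t : Fin 3, GL {i : Fin 3 // (id : Fin 3 → Fin 3) i = t} F) => ((((∏ i : Fin 3, ((![a, a * ((unramifiedTwist F 1 : QuasiChar F).toMonoidHom), a * ((unramifiedTwist F 1 : QuasiChar F).toMonoidHom) * ((unramifiedTwist F 1 : QuasiChar F).toMonoidHom)] : Fin 3 → (Fˣ →* ℂˣ)) i).comp (Matrix.GeneralLinearGroup.det.comp (Pi.evalMonoidHom (fun t : Fin 3 => GL {i : Fin 3 // (id : Fin 3 → Fin 3) i = t} F) i)))) m : ℂˣ) : ℂ)) then 1 else 0))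
    (hS₁₂ : ∀ {Y : Type} [AddCommGroup Y] [Module ℂ Y] (V : Representation ℂ (GL (Fin 3) F) Y), V.IsSmooth → ∀ [FiniteDimensional ℂ (Representation.restrictUnipotentGL F (id : Fin 3 → Fin 3) V).Coinvariants],
      finrank ℂ ↥(⨅ m, Module.End.maxGenEigenspace (Representation.normalizedJacquetGL F (id : Fin 3 → Fin 3) V m) (((((∏ i : Fin 3, ((![a * ((unramifiedTwist F 1 : QuasiChar F).toMonoidHom), a, a * ((unramifiedTwist F 1 : QuasiChar F).toMonoidHom) * ((unramifiedTwist F 1 : QuasiChar F).toMonoidHom)] : Fin 3 → (Fˣ →* ℂˣ)) i).comp (Matrix.GeneralLinearGroup.det.comp (Pi.evalMonoidHom (fun t : Fin 3 => GL {i : Fin 3 // (id : Fin 3 → Fin 3) i = t} F) i)))) m : ℂˣ) : ℂ))) =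
        finrank ℂ ↥(⨅ m, Module.End.maxGenEigenspace (Representation.normalizedJacquetGL F (id : Fin 3 → Fin 3) V m) (((((∏ i : Fin 3, ((![a * ((unramifiedTwist F 1 : QuasiChar F).toMonoidHom), a * ((unramifiedTwist F 1 : QuasiChar F).toMonoidHom) * ((unramifiedTwist F 1 : QuasiChar F).toMonoidHom), a] : Fin 3 → (Fˣ →* ℂˣ)) i).comp (Matrix.GeneralLinearGroup.det.comp (Pi.evalMonoidHom (fun t : Fin 3 => GL {i : Fin 3 // (id : Fin 3 → Fin 3) i = t} F) i)))) m : ℂˣ) : ℂ))))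
    (hJ₄' : (∀ r : SmoothIrrep (GL (Fin 3) F), (IrrClass.mk r).IsConstituentOf (Representation.parabolicIndGL F (id : Fin 3 → Fin 3) ((Representation.trivial ℂ (Π t : Fin 3, GL {i : Fin 3 // (id : Fin 3 → Fin 3) i = t} F) ℂ).twist (∏ i : Fin 3, ((![a * ((unramifiedTwist F 1 : QuasiChar F).toMonoidHom), a * ((unramifiedTwist F 1 : QuasiChar F).toMonoidHom) * ((unramifiedTwist F 1 : QuasiChar F).toMonoidHom), a] : Fin 3 → (Fˣ →* ℂˣ)) i).comp (Matrix.GeneralLinearGroup.det.comp (Pi.evalMonoidHom (fun t : Fin 3 => GL {i : Fin 3 // (id : Fin 3 → Fin 3) i = t} F) i))))) → Nontrivial (Representation.restrictUnipotentGL F (id : Fin 3 → Fin 3) r.ρ).Coinvariants)) {Y : Type} [AddCommGroup Y] [Module ℂ Y] (W : Representation ℂ (GL (Fin 3) F) Y) [W.IsIrreducible] (hW : W.IsSmooth)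
    [FiniteDimensional ℂ (Representation.restrictUnipotentGL F (id : Fin 3 → Fin 3) W).Coinvariants]
    (h : finrank ℂ ↥(⨅ m, Module.End.maxGenEigenspace (Representation.normalizedJacquetGL F (id : Fin 3 → Fin 3) W m) (((((∏ i : Fin 3, ((![a * ((unramifiedTwist F 1 : QuasiChar F).toMonoidHom), a, a * ((unramifiedTwist F 1 : QuasiChar F).toMonoidHom) * ((unramifiedTwist F 1 : QuasiChar F).toMonoidHom)] : Fin 3 → (Fˣ →* ℂˣ)) i).comp (Matrix.GeneralLinearGroup.det.comp (Pi.evalMonoidHom (fun t : Fin 3 => GL {i : Fin 3 // (id : Fin 3 → Fin 3) i = t} F) i)))) m : ℂˣ) : ℂ))) ≠ 0 ∨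
      finrank ℂ ↥(⨅ m, Module.End.maxGenEigenspace (Representation.normalizedJacquetGL F (id : Fin 3 → Fin 3) W m) (((((∏ i : Fin 3, ((![a * ((unramifiedTwist F 1 : QuasiChar F).toMonoidHom), a * ((unramifiedTwist F 1 : QuasiChar F).toMonoidHom) * ((unramifiedTwist F 1 : QuasiChar F).toMonoidHom), a] : Fin 3 → (Fˣ →* ℂˣ)) i).comp (Matrix.GeneralLinearGroup.det.comp (Pi.evalMonoidHom (fun t : Fin 3 => GL {i : Fin 3 // (id : Fin 3 → Fin 3) i = t} F) i)))) m : ℂˣ) : ℂ))) ≠ 0)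
    (Λ : W.IntertwiningMap (Representation.parabolicIndGL F (![false, false, true] : Fin 3 → Bool) ((Representation.trivial ℂ (Π t : Bool, GL {i : Fin 3 // (![false, false, true] : Fin 3 → Bool) i = t} F) ℂ).twist ((a * ((unramifiedTwist F 1 : QuasiChar F).toMonoidHom) * ((unramifiedTwist F (1 / 2) : QuasiChar F).toMonoidHom)).comp ((Matrix.GeneralLinearGroup.det : GL {i : Fin 3 // (![false, false, true] : Fin 3 → Bool) i = false} F →* Fˣ).comp (Pi.evalMonoidHom (fun t : Bool => GL {i : Fin 3 // (![false, false, true] : Fin 3 → Bool) i = t} F) false)) * (a).comp ((Matrix.GeneralLinearGroup.det : GL {i : Fin 3 // (![false, false, true] : Fin 3 → Bool) i = true} F →* Fˣ).comp (Pi.evalMonoidHom (fun t : Bool => GL {i : Fin 3 // (![false, false, true] : Fin 3 → Bool) i = t} F) true)))))) (hΛ : Function.Injective Λ) :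
    Nonempty (Λ.range.quotientRep.Equiv ((Representation.trivial ℂ (GL (Fin 3) F) ℂ).twist ((a * ((unramifiedTwist F 1 : QuasiChar F).toMonoidHom)).comp (Matrix.GeneralLinearGroup.det : GL (Fin 3) F →* Fˣ)))) := by
  have hD's := (isAdmissible_D'_cube a ha).isSmooth
  have h_ob := weights_quotient_D' a ha hD' hS₁₂ W hW h Λ hΛ
  obtain ⟨hQ1, hQ0⟩ := h_ob
  have hQs : Λ.range.quotientRep.IsSmooth := hD's.of_surjective Λ.range.mkQ Λ.range.mkQ_surjective
  haveI : FiniteDimensional ℂ (Representation.restrictUnipotentGL F (id : Fin 3 → Fin 3) Λ.range.quotientRep).Coinvariants := finiteDimensional_jacquet_quotientRep (Representation.parabolicIndGL F (![false, false, true] : Fin 3 → Bool) ((Representation.trivial ℂ (Π t : Bool, GL {i : Fin 3 // (![false, false, true] : Fin 3 → Bool) i = t} F) ℂ).twist ((a * ((unramifiedTwist F 1 : QuasiChar F).toMonoidHom) * ((unramifiedTwist F (1 / 2) : QuasiChar F).toMonoidHom)).comp ((Matrix.GeneralLinearGroup.det : GL {i : Fin 3 // (![false, false, true] : Fin 3 →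 Bool) i = false} F →* Fˣ).comp (Pi.evalMonoidHom (fun t : Bool => GL {i : Fin 3 // (![false, false, true] : Fin 3 → Bool) i = t} F) false)) * (a).comp ((Matrix.GeneralLinearGroup.det : GL {i : Fin 3 // (![false, false, true] : Fin 3 → Bool) i = true} F →* Fˣ).comp (Pi.evalMonoidHom (fun t : Bool => GL {i : Fin 3 // (![false, false, true] : Fin 3 → Bool) i = t} F) true))))) Λ.range
  haveI := nontrivial_of_finrank_weightSpace_ne_zero Λ.range.quotientRep _ (by rw [hQ1]; exact one_ne_zero)
  have h_ob := exists_injective_intertwiningMap_D' a ha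
  obtain ⟨ΦD, hΦD⟩ := h_ob
  have hJQ : (∀ r : SmoothIrrep (GL (Fin 3) F), (IrrClass.mk r).IsConstituentOf Λ.range.quotientRep → Nontrivial (Representation.restrictUnipotentGL F (id : Fin 3 → Fin 3) r.ρ).Coinvariants) := fun r hr => hJ₄' r ((hr.of_quotientRep Λ.range).of_injective ΦD hΦD)
  haveI : Λ.range.quotientRep.IsIrreducible := isIrreducible_of_finrank_weightSpace_le_one Λ.range.quotientRep hQs hJQ _ hQ1.le hQ0
  exact nonempty_equiv_pi_of_weight_C₁ a ha Λ.range.quotientRep hQs (by rw [hQ1]; exact one_ne_zero)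

include ha in
/-- **THE W-TRICK, trace half: `tr W = tr D′ − tr π₁`** for an irreducible smooth `W` with a C₄-class weight (`D′` admissible: `tr D′ = tr Λ(W) + tr (D′⁄Λ(W)) = tr W + tr π₁`).
[cite: Zelevinsky1980, Thm. 6.1, Cor. 7.5, §9] [cite: BernsteinZelevinsky1977, §2.3, Cor. 2.13] -/
theorem smoothTrace_of_weight_C₄ [FiniteDimensional ℂ (Representation.restrictUnipotentGL F (id : Fin 3 → Fin 3) (Representation.parabolicIndGL F (![false, false, true] : Fin 3 → Bool) ((Representation.trivial ℂ (Π t : Bool, GL {i : Fin 3 // (![false, false, true] : Fin 3 → Bool) i = t} F) ℂ).twist ((a * ((unramifiedTwist F 1 : QuasiChar F).toMonoidHom) * ((unramifiedTwist F (1 / 2) : QuasiChar F).toMonoidHom)).comp ((Matrix.GeneralLinearGroup.det : GL {i : Fin 3 // (![false, false, true] : Fin 3 → Bool) i = false} F →* Fˣ).comp (Pi.evalMonoidHom (fun t : Bool => GL {i : Fin 3 // (![false, false, true] : Fin 3 → Bool) i = t} F) false)) * (a).comp ((Matrix.GeneralLinearGroup.det : GL {i : Fin 3 // (![false, false, true]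 : Fin 3 → Bool) i = true} F →* Fˣ).comp (Pi.evalMonoidHom (fun t : Bool => GL {i : Fin 3 // (![false, false, true] : Fin 3 → Bool) i = t} F) true)))))).Coinvariants]
    (hD' : ∀ ζ : (Π t : Fin 3, GL {i : Fin 3 // (id : Fin 3 → Fin 3) i = t} F) → ℂ, finrank ℂ ↥(⨅ m, Module.End.maxGenEigenspace (Representation.normalizedJacquetGL F (id : Fin 3 → Fin 3) (Representation.parabolicIndGL F (![false, false, true] : Fin 3 → Bool) ((Representation.trivial ℂ (Π t : Bool, GL {i : Fin 3 // (![false, false, true] : Fin 3 → Bool) i = t} F) ℂ).twist ((a * ((unramifiedTwist F 1 : QuasiChar F).toMonoidHom) * ((unramifiedTwist F (1 / 2) : QuasiChar F).toMonoidHom)).comp ((Matrix.GeneralLinearGroup.det : GL {i : Fin 3 // (![false, false, true] : Fin 3 → Bool) i = false} F →* Fˣ).comp (Pi.evalMonoidHom (fun t : Bool => GL {i : Fin 3 // (![false, false, true] : Fin 3 → Bool) i = t} F) false)) * (a).comp ((Matrix.GeneralLinearGroup.det : GL {i : Fin 3 // (![false, false, true] : Fin 3 → Bool) i = true} F →* Fˣ).comp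 (Pi.evalMonoidHom (fun t : Bool => GL {i : Fin 3 // (![false, false, true] : Fin 3 → Bool) i = t} F) true))))) m) (ζ m)) =
      (if ζ = (fun m : (Π t : Fin 3, GL {i : Fin 3 // (id : Fin 3 → Fin 3) i = t} F) => ((((∏ i : Fin 3, ((![a * ((unramifiedTwist F 1 : QuasiChar F).toMonoidHom), a * ((unramifiedTwist F 1 : QuasiChar F).toMonoidHom) * ((unramifiedTwist F 1 : QuasiChar F).toMonoidHom), a] : Fin 3 → (Fˣ →* ℂˣ)) i).comp (Matrix.GeneralLinearGroup.det.comp (Pi.evalMonoidHom (fun t : Fin 3 => GL {i : Fin 3 // (id : Fin 3 → Fin 3) i = t} F) i)))) m : ℂˣ) : ℂ)) then 1 else 0) + (if ζ = (fun m : (Π t : Fin 3, GL {i : Fin 3 // (id : Fin 3 → Fin 3) i = t} F) => ((((∏ i : Fin 3, ((![a * ((unramifiedTwist F 1 : QuasiChar F).toMonoidHom), a, a * ((unramifiedTwist F 1 : QuasiChar F).toMonoidHom) * ((unramifiedTwist F 1 : QuasiChar F).toMonoidHom)] : Fin 3 → (Fˣ →* ℂˣ)) i).comp (Matrix.GeneralLinearGroup.det.comp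 (Pi.evalMonoidHom (fun t : Fin 3 => GL {i : Fin 3 // (id : Fin 3 → Fin 3) i = t} F) i)))) m : ℂˣ) : ℂ)) then 1 else 0) + (if ζ = (fun m : (Π t : Fin 3, GL {i : Fin 3 // (id : Fin 3 → Fin 3) i = t} F) => ((((∏ i : Fin 3, ((![a, a * ((unramifiedTwist F 1 : QuasiChar F).toMonoidHom), a * ((unramifiedTwist F 1 : QuasiChar F).toMonoidHom) * ((unramifiedTwist F 1 : QuasiChar F).toMonoidHom)] : Fin 3 → (Fˣ →* ℂˣ)) i).comp (Matrix.GeneralLinearGroup.det.comp (Pi.evalMonoidHom (fun t : Fin 3 => GL {i : Fin 3 // (id : Fin 3 → Fin 3) i = t} F) i)))) m : ℂˣ) : ℂ)) then 1 else 0))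
    (hS₁₂ : ∀ {Y : Type} [AddCommGroup Y] [Module ℂ Y] (V : Representation ℂ (GL (Fin 3) F) Y), V.IsSmooth → ∀ [FiniteDimensional ℂ (Representation.restrictUnipotentGL F (id : Fin 3 → Fin 3) V).Coinvariants],
      finrank ℂ ↥(⨅ m, Module.End.maxGenEigenspace (Representation.normalizedJacquetGL F (id : Fin 3 → Fin 3) V m) (((((∏ i : Fin 3, ((![a * ((unramifiedTwist F 1 : QuasiChar F).toMonoidHom), a, a * ((unramifiedTwist F 1 : QuasiChar F).toMonoidHom) * ((unramifiedTwist F 1 : QuasiChar F).toMonoidHom)] : Fin 3 → (Fˣ →* ℂˣ)) i).comp (Matrix.GeneralLinearGroup.det.comp (Pi.evalMonoidHom (fun t : Fin 3 => GL {i : Fin 3 // (id : Fin 3 → Fin 3) i = t} F) i)))) m : ℂˣ) : ℂ))) =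
        finrank ℂ ↥(⨅ m, Module.End.maxGenEigenspace (Representation.normalizedJacquetGL F (id : Fin 3 → Fin 3) V m) (((((∏ i : Fin 3, ((![a * ((unramifiedTwist F 1 : QuasiChar F).toMonoidHom), a * ((unramifiedTwist F 1 : QuasiChar F).toMonoidHom) * ((unramifiedTwist F 1 : QuasiChar F).toMonoidHom), a] : Fin 3 → (Fˣ →* ℂˣ)) i).comp (Matrix.GeneralLinearGroup.det.comp (Pi.evalMonoidHom (fun t : Fin 3 => GL {i : Fin 3 // (id : Fin 3 → Fin 3) i = t} F) i)))) m : ℂˣ) : ℂ))))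
    (hJ₄' : (∀ r : SmoothIrrep (GL (Fin 3) F), (IrrClass.mk r).IsConstituentOf (Representation.parabolicIndGL F (id : Fin 3 → Fin 3) ((Representation.trivial ℂ (Π t : Fin 3, GL {i : Fin 3 // (id : Fin 3 → Fin 3) i = t} F) ℂ).twist (∏ i : Fin 3, ((![a * ((unramifiedTwist F 1 : QuasiChar F).toMonoidHom), a * ((unramifiedTwist F 1 : QuasiChar F).toMonoidHom) * ((unramifiedTwist F 1 : QuasiChar F).toMonoidHom), a] : Fin 3 → (Fˣ →* ℂˣ)) i).comp (Matrix.GeneralLinearGroup.det.comp (Pi.evalMonoidHom (fun t : Fin 3 => GL {i : Fin 3 // (id : Fin 3 → Fin 3) i = t} F) i))))) → Nontrivial (Representation.restrictUnipotentGL F (id : Fin 3 → Fin 3) r.ρ).Coinvariants)) {Y : Type} [AddCommGroup Y] [Module ℂ Y] (W : Representation ℂ (GL (Fin 3) F) Y) [W.IsIrreducible] (hW : W.IsSmooth)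
    [FiniteDimensional ℂ (Representation.restrictUnipotentGL F (id : Fin 3 → Fin 3) W).Coinvariants]
    (h : finrank ℂ ↥(⨅ m, Module.End.maxGenEigenspace (Representation.normalizedJacquetGL F (id : Fin 3 → Fin 3) W m) (((((∏ i : Fin 3, ((![a * ((unramifiedTwist F 1 : QuasiChar F).toMonoidHom), a, a * ((unramifiedTwist F 1 : QuasiChar F).toMonoidHom) * ((unramifiedTwist F 1 : QuasiChar F).toMonoidHom)] : Fin 3 → (Fˣ →* ℂˣ)) i).comp (Matrix.GeneralLinearGroup.det.comp (Pi.evalMonoidHom (fun t : Fin 3 => GL {i : Fin 3 // (id : Fin 3 → Fin 3) i = t} F) i)))) m : ℂˣ) : ℂ))) ≠ 0 ∨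
      finrank ℂ ↥(⨅ m, Module.End.maxGenEigenspace (Representation.normalizedJacquetGL F (id : Fin 3 → Fin 3) W m) (((((∏ i : Fin 3, ((![a * ((unramifiedTwist F 1 : QuasiChar F).toMonoidHom), a * ((unramifiedTwist F 1 : QuasiChar F).toMonoidHom) * ((unramifiedTwist F 1 : QuasiChar F).toMonoidHom), a] : Fin 3 → (Fˣ →* ℂˣ)) i).comp (Matrix.GeneralLinearGroup.det.comp (Pi.evalMonoidHom (fun t : Fin 3 => GL {i : Fin 3 // (id : Fin 3 → Fin 3) i = t} F) i)))) m : ℂˣ) : ℂ))) ≠ 0)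
    [MeasurableSpace (GL (Fin 3) F)] [BorelSpace (GL (Fin 3) F)] (μ : Measure (GL (Fin 3) F)) [IsFiniteMeasureOnCompacts μ] (f : GL (Fin 3) F → ℂ) :
    W.smoothTrace μ f = (Representation.parabolicIndGL F (![false, false, true] : Fin 3 → Bool) ((Representation.trivial ℂ (Π t : Bool, GL {i : Fin 3 // (![false, false, true] : Fin 3 → Bool) i = t} F) ℂ).twist ((a * ((unramifiedTwist F 1 : QuasiChar F).toMonoidHom) * ((unramifiedTwist F (1 / 2) : QuasiChar F).toMonoidHom)).comp ((Matrix.GeneralLinearGroup.det : GL {i : Fin 3 // (![false, false, true] : Fin 3 → Bool) i = false} F →* Fˣ).comp (Pi.evalMonoidHom (fun t : Bool => GL {i : Fin 3 // (![false, false, true] : Fin 3 → Bool) i = t} F) false)) * (a).comp ((Matrix.GeneralLinearGroup.det : GL {i : Fin 3 // (![false, false, true] : Fin 3 → Bool) i = true} F →* Fˣ).comp (Pi.evalMonoidHom (fun t : Bool => GL {i : Fin 3 // (![false, false, true] : Fin 3 → Bool) i = t} F) true))))).smoothTrace μ f - ((Representation.trivial ℂ (GL (Fin 3) F) ℂ).twist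 ((a * ((unramifiedTwist F 1 : QuasiChar F).toMonoidHom)).comp (Matrix.GeneralLinearGroup.det : GL (Fin 3) F →* Fˣ))).smoothTrace μ f := by
  have h_ob := exists_injective_intertwiningMap_D'_of_weight_C₄ a ha hD' hS₁₂ W hW h
  obtain ⟨Λ, hΛ⟩ := h_ob
  have h_ob := nonempty_equiv_range Λ hΛ
  obtain ⟨eW⟩ := h_ob
  have h_ob := nonempty_equiv_pi_quotient_D' a ha hD' hS₁₂ hJ₄' W hW h Λ hΛ
  obtain ⟨eQ⟩ := h_ob
  rw [Representation.smoothTrace_eq_add_of_subrepresentation _ μ (isAdmissible_D'_cube a ha) Λ.range f, Representation.smoothTrace_eq_of_equiv _ μ eW,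
    ← Representation.smoothTrace_eq_of_equiv _ μ eQ]
  ring


end Summit.HodgeConjecture.HodgeConjecture.Cruxes.H413.K2E3GL3CubeClassFour

end
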